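import Literature.NumberTheory.ConnesConsani2021.QuasiInnerArchPrimeResidues
import Literature.NumberTheory.ConnesConsani2021.QuasiInnerGaussFactors
import HarnessLib

/-!
# Connes–Consani 2021 (JNT) §4.4, proof of Theorem 4.8 — the residue computation of the negative Fourier
# coefficients of `(ρ_∞^{(m,k)}ρ_p) ∘ ψ` (PROVED)

LINE 1 — LABEL: RH-FREE corpus literature (function theory of the product of the Gauss-multiplication
factor `ρ_∞^{(m,k)}` of `ρ_∞` (Lemma 4.7) with one non-archimedean ratio `ρ_p` on `∂ℂ₋`: a contour integral
of a meromorphic function); bears_on: W-C/W-P (P5 sequel vocabulary, no leaf role); WHAT THIS IS NOT: any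
claim about RH — nothing in this file bears on the truth of RH.

Source: A. Connes, C. Consani, *Quasi-inner functions and local factors*, J. Number Theory **226**
(2021) 139–167 = arXiv:2008.10974 [bib: `ConnesConsani2021QuasiInner`], proof of Theorem 4.8 (arXiv
chunk p0014:L64: «The results of §4.3 continue to hold with minor changes if one replaces `ρ_∞` by
`ρ_∞^{(m,k)}`. The only substantial change is that the decay of the terms `|ρ_∞^{(m,k)}(2πin/log p)|` is now
governed by Lemma 4.6 (i)») with the proof of Theorem 4.4 (ii) (p0011:L102–p0012:L35) run for
`ρ_∞^{(m,k)}ρ_p`: «the same contour as in Section 2 and the same choice `R = (2m+1)π/log p` … The poles are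
of three kinds»: the poles `−2k − 2mn` of `ρ_∞^{(m,k)}` (Lemma 4.7: «the arithmetic progression
`z = −2k − 2nm`»), the non-zero poles `2πin/log p` of `ρ_p`, and the pole at `z = 0` (double when `k = 0`,
simple — a pole of `ρ_p` alone — when `k ≥ 1`). THEOREMS ONLY; this is the file
`QuasiInnerArchPrimeResidues.lean` (the case `m = 1`, `k = 0`, `ρ_∞^{(1,0)} = ρ_∞`) run for a general factor,
on the landed function theory of `ρ_∞^{(m,k)}` (`QuasiInnerGaussFactors.lean`: simple poles and residues,
Stirling bound on strips, the functional-equation bound on the lines `Re z = ½ − 2mJ`).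

## What is proved (theorems only)

With `F_ℓ(z) = ρ_∞^{(m,k)}(z)ρ_p(z)(2z+1)^ℓ(2z−3)^{−ℓ−2}`, `0 ≤ k < m`:
* the pole structure of `F_ℓ` (`exists_factorPrime_eq_div_sub_archPole`, `…_primePole`,
  `exists_factorPrime_doublePole_sub`: at `0` the principal part is `az⁻² + (A + Bℓ)x_0^ℓ z⁻¹` for two
  constants `A`, `B` depending only on `m, k, p`);
* the residue theorem on `[½ − 2mj, ½] × [−R_M, R_M]`, `R_M = (2M+1)π/log p`, then `M → ∞`, `j → ∞`;
* **`exists_fourierCoeff_kappaFactorPrime_eq`**: there are `A B : ℂ` with, for every `ℓ ≥ 0`,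
  `((ρ_∞^{(m,k)}ρ_p)∘ψ)^(−ℓ−1) = Σ_{n ≥ 0, (k,n) ≠ (0,0)} c_n x_n^ℓ
   + Σ_{n≠0} ρ_∞^{(m,k)}(2πin/log p)·8(1−p⁻¹)log p(4πn+3i log p)⁻² x_p(n)^ℓ + (A + Bℓ)(−⅓)^ℓ`,
  `x_n = ψ⁻¹(−2k−2mn)`, `c_n = −8 r_n ρ_p(−2k−2mn)(2(−2k−2mn)−3)⁻²` (`r_n` the residue of `ρ_∞^{(m,k)}`).

No definitions, no named facts; nothing here bears on the truth of RH.
-/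

noncomputable section

open _root_.MeasureTheory _root_.Complex AddCircle Filter Set
open scoped Real Topology Nat Interval

namespace Literature.NumberTheory.ConnesConsani2021

namespace QuasiInner

/-! ### A. Plumbing -/

section Plumbing

/-- RH-FREE. `ρ_p` is complex differentiable off its poles `2πiℤ/log p`.
[cite: ConnesConsani2021QuasiInner, Lemma 3.1 (ii) (arXiv chunk p0008:L11–L17)] -/
private theorem fp_differentiableAt_rhoPrime' {p : ℕ} (hp : 1 < p) {z : ℂ}
    (hz : ∀ k : ℤ, z ≠ 2 * π * I * k / Real.log p) : DifferentiableAt ℂ (rhoPrime p) z := by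
  have hp0 : (p : ℂ) ≠ 0 := Nat.cast_ne_zero.2 (by omega)
  have hD : (1 - (p : ℂ) ^ (-z)) ≠ 0 := by
    intro h
    obtain ⟨k, hk⟩ := (natCast_cpow_neg_eq_one_iff hp z).1 (sub_eq_zero.1 h).symm
    exact hz k hk
  have h1 : DifferentiableAt ℂ (fun w : ℂ => 1 - (p : ℂ) ^ (w - 1)) z :=
    (differentiableAt_const _).sub ((differentiableAt_id.sub (differentiableAt_const _)).const_cpow
      (Or.inl hp0))
  have h2 : DifferentiableAt ℂ (fun w : ℂ => 1 - (p : ℂ) ^ (-w)) z :=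
    (differentiableAt_const _).sub (differentiableAt_id.neg.const_cpow (Or.inl hp0))
  have heq : rhoPrime p = fun w => (1 - (p : ℂ) ^ (w - 1)) / (1 - (p : ℂ) ^ (-w)) := rfl
  rw [heq]
  exact h1.div h2 hD

/-- RH-FREE. `ρ_p` is complex differentiable off the imaginary axis.
[cite: ConnesConsani2021QuasiInner, Lemma 3.1 (ii) (arXiv chunk p0008:L11–L17)] -/
private theorem fp_differentiableAt_rhoPrime {p : ℕ} (hp : 1 < p) {z : ℂ} (hz : z.re ≠ 0) :
    DifferentiableAt ℂ (rhoPrime p) z := by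
  refine fp_differentiableAt_rhoPrime' hp fun k hk => hz ?_
  rw [hk, Complex.div_ofReal_re]
  simp

/-- RH-FREE. `γ_{m,k}(z) ≠ 0` off the real axis. [cite: ConnesConsani2021QuasiInner, Lemma 4.7 proof (arXiv chunk p0014:L56)] -/
private theorem fp_gammaFactor_ne_zero_of_im_ne {m : ℕ} (hm : 0 < m) (k : ℕ) {z : ℂ} (hz : z.im ≠ 0) :
    gammaFactor m k z ≠ 0 := by
  intro h
  obtain ⟨n, hn⟩ := (gammaFactor_eq_zero_iff hm k z).1 h
  apply hz
  rw [hn]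
  simp

/-- RH-FREE. `γ_{m,k}(z) ≠ 0` unless `Re z = −2k − 2mn` for some `n`. [cite: ConnesConsani2021QuasiInner, Lemma 4.7 proof (arXiv chunk p0014:L56)] -/
private theorem fp_gammaFactor_ne_zero_of_re_ne {m : ℕ} (hm : 0 < m) (k : ℕ) {z : ℂ}
    (hz : ∀ n : ℕ, z.re ≠ -(2 * k + 2 * m * n)) : gammaFactor m k z ≠ 0 := by
  intro h
  obtain ⟨n, hn⟩ := (gammaFactor_eq_zero_iff hm k z).1 h
  apply hz n
  rw [hn]
  simp
  ring

/-- RH-FREE. The two kernels: `ψ⁻¹(z)^ℓ(ψ⁻¹)′(z) = −8(2z+1)^ℓ(2z−3)^{−ℓ−2}`. [folklore] -/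
private theorem fp_kernel_eq (z : ℂ) (ℓ : ℕ) :
    cayleyInv z ^ ℓ * ((-8 : ℂ) / (2 * z - 3) ^ 2) = -8 * ((2 * z + 1) ^ ℓ / (2 * z - 3) ^ (ℓ + 2)) := by
  rw [cayleyInv, div_pow, pow_add, div_mul_div_comm, mul_comm ((2 * z + 1) ^ ℓ) (-8 : ℂ), mul_div_assoc]

/-- RH-FREE. The kernel as `x^ℓ/(2z−3)²`: `(2z+1)^ℓ(2z−3)^{−ℓ−2} = ψ⁻¹(z)^ℓ/(2z−3)²`. [folklore] -/
private theorem fp_kernel_eq' {z : ℂ} (hz : z.re < 3 / 2) (ℓ : ℕ) :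
    (2 * z + 1) ^ ℓ / (2 * z - 3) ^ (ℓ + 2) = cayleyInv z ^ ℓ / (2 * z - 3) ^ 2 := by
  have h3 : (2 * z - 3 : ℂ) ≠ 0 := by
    intro h
    have := congrArg Complex.re h
    simp at this
    linarith
  rw [cayleyInv, div_pow, pow_add, div_div]

/-- RH-FREE. The kernel is differentiable off `z = 3/2`. [folklore] -/
private theorem fp_differentiableAt_kernel {z : ℂ} (hz : z.re < 3 / 2) (ℓ : ℕ) :
    DifferentiableAt ℂ (fun w : ℂ => (2 * w + 1) ^ ℓ / (2 * w - 3) ^ (ℓ + 2)) z := by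
  have h3 : (2 * z - 3) ^ (ℓ + 2) ≠ 0 := by
    apply pow_ne_zero
    intro h
    have := congrArg Complex.re h
    simp at this
    linarith
  refine DifferentiableAt.div ?_ ?_ h3 <;> fun_prop

/-- RH-FREE. The integrand `F_ℓ = ρ_∞^{(m,k)}ρ_p(2z+1)^ℓ(2z−3)^{−ℓ−2}` is complex differentiable off the
poles of `ρ_∞^{(m,k)}` and `ρ_p` in `Re z < 3/2`. [folklore] -/
private theorem fp_differentiableAt_F {m : ℕ} (hm : 0 < m) (k : ℕ) {p : ℕ} (hp : 1 < p) (ℓ : ℕ) {z : ℂ}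
    (hG : gammaFactor m k z ≠ 0) (hre : z.re ≠ 0) (hz : z.re < 3 / 2) :
    DifferentiableAt ℂ
      (fun w : ℂ => rhoFactor m k w * rhoPrime p w * ((2 * w + 1) ^ ℓ / (2 * w - 3) ^ (ℓ + 2))) z :=
  ((differentiableAt_rhoFactor hm k hG).mul (fp_differentiableAt_rhoPrime hp hre)).mul
    (fp_differentiableAt_kernel hz ℓ)

end Plumbing

/-! ### B. The three kinds of poles of `F_ℓ = ρ_∞^{(m,k)}ρ_p(2z+1)^ℓ(2z−3)^{−ℓ−2}` -/

section Poles

/-- RH-FREE. **The poles of `ρ_∞^{(m,k)}` away from `0`**: near `p_n = −2k − 2mn` (`p_n ≠ 0`) one has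
`F_ℓ = φ/(z − p_n)` with `φ` holomorphic on `|z − p_n| < 1` and `φ(p_n) = r_n · ρ_p(p_n) K_ℓ(p_n)` («the
residues are, for the simple poles, multiplied by the value of the other factor at the point»; `r_n` the
residue of `ρ_∞^{(m,k)}` of `exists_rhoFactor_eq_div_sub_pole`).
[cite: ConnesConsani2021QuasiInner, Thm 4.8 proof (arXiv chunk p0014:L64) with Thm 4.4 proof (p0012:L5–L7)] -/
theorem exists_factorPrime_eq_div_sub_archPole {m : ℕ} (hm : 0 < m) (k : ℕ) {p : ℕ} (hp : 1 < p) (ℓ : ℕ)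
    {n : ℕ} (hn : ¬(k = 0 ∧ n = 0)) :
    ∃ ψ : ℂ → ℂ, DifferentiableOn ℂ ψ (Metric.ball (-(2 * (k : ℂ) + 2 * (m : ℂ) * (n : ℂ))) 1) ∧
      ψ (-(2 * (k : ℂ) + 2 * (m : ℂ) * (n : ℂ))) =
        (2 * (m : ℂ) * ((π : ℂ) / m) ^ (1 / (2 * (m : ℂ)) - (-(2 * (k : ℂ) + 2 * (m : ℂ) * (n : ℂ))) / m) *
          (Complex.Gamma ((1 - (-(2 * (k : ℂ) + 2 * (m : ℂ) * (n : ℂ)))) / (2 * (m : ℂ)) + (k : ℂ) / (m : ℂ)))⁻¹ /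
            ((-1) ^ n * (n ! : ℂ))) *
          (rhoPrime p (-(2 * (k : ℂ) + 2 * (m : ℂ) * (n : ℂ))) *
            ((2 * (-(2 * (k : ℂ) + 2 * (m : ℂ) * (n : ℂ))) + 1) ^ ℓ /
              (2 * (-(2 * (k : ℂ) + 2 * (m : ℂ) * (n : ℂ))) - 3) ^ (ℓ + 2))) ∧
      ∀ z ∈ Metric.ball (-(2 * (k : ℂ) + 2 * (m : ℂ) * (n : ℂ))) 1, z ≠ -(2 * (k : ℂ) + 2 * (m : ℂ) * (n : ℂ)) →
        rhoFactor m k z * rhoPrime p z * ((2 * z + 1) ^ ℓ / (2 * z - 3) ^ (ℓ + 2)) =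
          ψ z / (z - -(2 * (k : ℂ) + 2 * (m : ℂ) * (n : ℂ))) := by
  obtain ⟨Φ, hΦd, hΦv, hΦeq⟩ := exists_rhoFactor_eq_div_sub_pole hm k n
  -- `p_n ≤ −2`, so the unit ball around it lies in `Re z < −1`
  have hkn : (1 : ℝ) ≤ k + m * n := by
    rcases Nat.eq_zero_or_pos n with h0 | hpos
    · subst h0
      have hk : k ≠ 0 := fun h => hn ⟨h, rfl⟩
      have : (1 : ℝ) ≤ k := by exact_mod_cast Nat.one_le_iff_ne_zero.2 hk
      simpa using this
    · have h1 : (1 : ℝ) ≤ m * n := by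
        have : 1 ≤ m * n := Nat.one_le_iff_ne_zero.2 (Nat.mul_ne_zero hm.ne' hpos.ne')
        exact_mod_cast this
      linarith [(k.cast_nonneg : (0 : ℝ) ≤ k)]
  have hre_pole : (-(2 * (k : ℂ) + 2 * (m : ℂ) * (n : ℂ))).re = -(2 * k + 2 * m * n) := by
    simp
  have hball : ∀ z ∈ Metric.ball (-(2 * (k : ℂ) + 2 * (m : ℂ) * (n : ℂ))) 1, z.re < -1 := by
    intro z hz
    rw [Metric.mem_ball, dist_eq_norm] at hz
    have h1 : |(z - -(2 * (k : ℂ) + 2 * (m : ℂ) * (n : ℂ))).re| < 1 := (abs_re_le_norm _).trans_lt hz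
    rw [abs_lt, sub_re, hre_pole] at h1
    linarith [h1.2]
  refine ⟨fun z => Φ z * (rhoPrime p z * ((2 * z + 1) ^ ℓ / (2 * z - 3) ^ (ℓ + 2))), ?_, ?_, ?_⟩
  · intro z hz
    have hre := hball z hz
    exact (hΦd z hz).mul (((fp_differentiableAt_rhoPrime hp (by linarith)).mul
      (fp_differentiableAt_kernel (by linarith) ℓ)).differentiableWithinAt)
  · simp only [hΦv]
  · intro z hz hzn
    rw [hΦeq z hz hzn]
    ring

/-- RH-FREE. **The non-zero poles of `ρ_p`**: near `z_n = 2πin/log p` (`n ≠ 0`) one has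
`F_ℓ = φ/(z − z_n)` with `φ` holomorphic near `z_n` and `φ(z_n) = ρ_∞^{(m,k)}(z_n)·(1 − p⁻¹)(log p)⁻¹K_ℓ(z_n)`
(«the decay of the terms `|ρ_∞^{(m,k)}(2πin/log p)|` is now governed by Lemma 4.6 (i)»).
[cite: ConnesConsani2021QuasiInner, Thm 4.8 proof (arXiv chunk p0014:L64) with Thm 4.4 proof (p0012:L7–L9)] -/
theorem exists_factorPrime_eq_div_sub_primePole {m : ℕ} (hm : 0 < m) (k : ℕ) {p : ℕ} (hp : 1 < p) (ℓ : ℕ)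
    {n : ℤ} (hn : n ≠ 0) :
    ∃ ψ : ℂ → ℂ, ∃ V ∈ 𝓝 (2 * π * I * n / Real.log p : ℂ), DifferentiableOn ℂ ψ V ∧
      ψ (2 * π * I * n / Real.log p) =
        rhoFactor m k (2 * π * I * n / Real.log p) * ((1 - (p : ℂ)⁻¹) / Real.log p *
          ((2 * (2 * π * I * n / Real.log p) + 1) ^ ℓ / (2 * (2 * π * I * n / Real.log p) - 3) ^ (ℓ + 2))) ∧
      ∀ z ∈ V, z ≠ 2 * π * I * n / Real.log p →
        rhoFactor m k z * rhoPrime p z * ((2 * z + 1) ^ ℓ / (2 * z - 3) ^ (ℓ + 2)) =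
          ψ z / (z - 2 * π * I * n / Real.log p) := by
  have hlogR : 0 < Real.log p := Real.log_pos (by exact_mod_cast hp)
  obtain ⟨ψ₀, V, hV, hd, hval, heq⟩ := exists_pole_structure_rhoPrime_kernel hp ℓ n
  set c : ℂ := 2 * π * I * n / Real.log p with hc
  have hcim : c.im = 2 * π * n / Real.log p := by rw [hc, Complex.div_ofReal_im]; simp
  have hcim0 : c.im ≠ 0 := by
    rw [hcim]
    have hn' : (n : ℝ) ≠ 0 := by exact_mod_cast hn
    have : 2 * π * (n : ℝ) ≠ 0 := by positivity
    exact div_ne_zero this hlogR.ne'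
  have hW : {w : ℂ | w.im ≠ 0} ∈ 𝓝 c :=
    (isOpen_ne_fun Complex.continuous_im continuous_const).mem_nhds hcim0
  refine ⟨fun w => rhoFactor m k w * (-(1 / 8 : ℂ) * ψ₀ w), V ∩ {w : ℂ | w.im ≠ 0}, inter_mem hV hW,
    ?_, ?_, ?_⟩
  · intro w hw
    exact ((differentiableAt_rhoFactor hm k
      (fp_gammaFactor_ne_zero_of_im_ne hm k hw.2)).differentiableWithinAt).mul
      (((hd w hw.1).const_mul _).mono inter_subset_left)
  · simp only [hval, fp_kernel_eq]
    ring
  · intro w hw hwc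
    have h := heq w hw.1 hwc
    rw [fp_kernel_eq] at h
    have h' : rhoPrime p w * ((2 * w + 1) ^ ℓ / (2 * w - 3) ^ (ℓ + 2)) =
        -(1 / 8 : ℂ) * (ψ₀ w / (w - c)) := by
      have e : rhoPrime p w * ((2 * w + 1) ^ ℓ / (2 * w - 3) ^ (ℓ + 2)) =
          -(1 / 8 : ℂ) * (rhoPrime p w * (-8 * ((2 * w + 1) ^ ℓ / (2 * w - 3) ^ (ℓ + 2)))) := by ring
      rw [e, h]
    rw [mul_assoc, h']
    ring

end Poles

/-! ### C. The pole at `z = 0`: principal part `az⁻² + (A + Bℓ)x_0^ℓ z⁻¹` -/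

section DoublePole

/-- RH-FREE. The kernel `K_ℓ` has derivative `ℓx_0^ℓ·(−3u₁)/9 + x_0^ℓ v₁` at `0` (`u₁ = (ψ⁻¹)′(0)`,
`v₁ = ((2z−3)^{−2})′(0)`). [folklore] -/
private theorem fp_hasDerivAt_kernel_zero (ℓ : ℕ) :
    HasDerivAt (fun w : ℂ => (2 * w + 1) ^ ℓ / (2 * w - 3) ^ (ℓ + 2))
      ((ℓ : ℂ) * (-1 / 3 : ℂ) ^ ℓ * (-3) * deriv cayleyInv 0 * (1 / 9) +
        (-1 / 3 : ℂ) ^ ℓ * deriv (fun w : ℂ => ((2 * w - 3) ^ 2)⁻¹) 0) 0 := by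
  have h3 : ∀ w : ℂ, w.re < 3 / 2 → (2 * w - 3 : ℂ) ≠ 0 := by
    intro w hw h
    have := congrArg Complex.re h
    simp at this
    linarith
  have hu : HasDerivAt cayleyInv (deriv cayleyInv 0) 0 := by
    have : DifferentiableAt ℂ cayleyInv 0 := by
      unfold cayleyInv
      exact DifferentiableAt.div (by fun_prop) (by fun_prop) (h3 0 (by norm_num))
    exact this.hasDerivAt
  have hv : HasDerivAt (fun w : ℂ => ((2 * w - 3) ^ 2)⁻¹) (deriv (fun w : ℂ => ((2 * w - 3) ^ 2)⁻¹) 0) 0 := by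
    have : DifferentiableAt ℂ (fun w : ℂ => ((2 * w - 3) ^ 2)⁻¹) 0 :=
      DifferentiableAt.inv (by fun_prop) (pow_ne_zero _ (h3 0 (by norm_num)))
    exact this.hasDerivAt
  have hpow : HasDerivAt (fun w : ℂ => cayleyInv w ^ ℓ)
      ((ℓ : ℂ) * (-1 / 3 : ℂ) ^ ℓ * (-3) * deriv cayleyInv 0) 0 := by
    have h := hu.fun_pow ℓ
    rw [cayleyInv_zero] at h
    refine h.congr_deriv ?_
    rcases Nat.eq_zero_or_pos ℓ with h0 | hpos
    · subst h0; simp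
    · obtain ⟨j, rfl⟩ := Nat.exists_eq_add_of_le hpos
      rw [show 1 + j - 1 = j by omega, pow_add, pow_one]
      ring
  have hK : HasDerivAt (fun w : ℂ => cayleyInv w ^ ℓ * ((2 * w - 3) ^ 2)⁻¹)
      ((ℓ : ℂ) * (-1 / 3 : ℂ) ^ ℓ * (-3) * deriv cayleyInv 0 * ((2 * (0 : ℂ) - 3) ^ 2)⁻¹ +
        cayleyInv 0 ^ ℓ * deriv (fun w : ℂ => ((2 * w - 3) ^ 2)⁻¹) 0) 0 := hpow.fun_mul hv
  have heq : (fun w : ℂ => (2 * w + 1) ^ ℓ / (2 * w - 3) ^ (ℓ + 2)) =ᶠ[𝓝 0]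
      fun w : ℂ => cayleyInv w ^ ℓ * ((2 * w - 3) ^ 2)⁻¹ := by
    have hopen : {w : ℂ | w.re < 3 / 2} ∈ 𝓝 (0 : ℂ) :=
      (isOpen_lt Complex.continuous_re continuous_const).mem_nhds (by norm_num)
    filter_upwards [hopen] with w hw
    have h3w := h3 w hw
    rw [cayleyInv, div_pow, pow_add]
    field_simp
  refine (hK.congr_of_eventuallyEq heq).congr_deriv ?_
  rw [cayleyInv_zero]
  norm_num

/-- RH-FREE. **The pole at `0` when `k = 0`** (`p_0 = 0` is a pole of `ρ_∞^{(m,0)}` and of `ρ_p`: a double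
pole of `F_ℓ`): `F_ℓ(z) = g(z)K_ℓ(z)/z²` near `0` with `g` holomorphic.
[cite: ConnesConsani2021QuasiInner, Thm 4.4 proof (arXiv chunk p0012:L21–L23), Thm 4.8 proof (p0014:L64)] -/
private theorem fp_exists_eq_div_sq_zero {m : ℕ} (hm : 0 < m) {p : ℕ} (hp : 1 < p) :
    ∃ g : ℂ → ℂ, ∃ W ∈ 𝓝 (0 : ℂ), W ⊆ Metric.ball (0 : ℂ) 1 ∧ DifferentiableOn ℂ g W ∧
      ∀ ℓ : ℕ, ∀ z ∈ W, z ≠ 0 →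
        rhoFactor m 0 z * rhoPrime p z * ((2 * z + 1) ^ ℓ / (2 * z - 3) ^ (ℓ + 2)) =
          g z * ((2 * z + 1) ^ ℓ / (2 * z - 3) ^ (ℓ + 2)) / z ^ 2 := by
  obtain ⟨Φ, hΦd, -, hΦeq⟩ := exists_rhoFactor_eq_div_sub_pole hm 0 0
  simp only [Nat.cast_zero, mul_zero, add_zero, neg_zero, sub_zero] at hΦd hΦeq
  obtain ⟨ψ₀, V, hV, hd, -, heq⟩ := exists_pole_structure_rhoPrime_kernel hp 0 0
  simp only [Int.cast_zero, mul_zero, zero_div, sub_zero, pow_zero, one_mul] at hV hd heq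
  refine ⟨fun z => Φ z * (-(1 / 8 : ℂ) * ψ₀ z * (2 * z - 3) ^ 2), Metric.ball (0 : ℂ) 1 ∩ V,
    inter_mem (Metric.ball_mem_nhds _ one_pos) hV, inter_subset_left, ?_, ?_⟩
  · intro z hz
    have h1 : DifferentiableWithinAt ℂ Φ (Metric.ball (0 : ℂ) 1 ∩ V) z := (hΦd z hz.1).mono inter_subset_left
    have h2 : DifferentiableWithinAt ℂ ψ₀ (Metric.ball (0 : ℂ) 1 ∩ V) z := (hd z hz.2).mono inter_subset_right
    have h3 : DifferentiableWithinAt ℂ (fun z : ℂ => (2 * z - 3) ^ 2) (Metric.ball (0 : ℂ) 1 ∩ V) z :=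
      (((differentiableAt_id.const_mul (2 : ℂ)).sub (differentiableAt_const (3 : ℂ))).pow 2).differentiableWithinAt
    exact h1.mul ((h2.const_mul _).mul h3)
  · intro ℓ z hz hz0
    have hre : z.re < 1 := by
      have h := hz.1
      rw [Metric.mem_ball, dist_zero_right] at h
      exact (abs_re_le_norm z |>.trans_lt h) |> (abs_lt.1 · |>.2)
    have h3 : (2 * z - 3 : ℂ) ≠ 0 := by
      intro h
      have := congrArg Complex.re h
      simp at this
      linarith
    have hρ : rhoPrime p z = -(1 / 8 : ℂ) * ψ₀ z * (2 * z - 3) ^ 2 / z := by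
      have hc : (-8 : ℂ) / (2 * z - 3) ^ 2 ≠ 0 := div_ne_zero (by norm_num) (pow_ne_zero _ h3)
      rw [eq_div_of_mul_eq hc (heq z hz.2 hz0)]
      field_simp
    rw [hΦeq z hz.1 hz0, hρ]
    field_simp

/-- RH-FREE. **The pole at `0`, split off**: there are constants `A`, `B` (depending only on `m, k, p`) such
that for every `ℓ` and some `a_ℓ` the function `F_ℓ − a_ℓz⁻² − (A + Bℓ)x_0^ℓ z⁻¹` has a removable singularity
at `0` (a «simple pole with residue `0`»). For `k = 0` this is the double pole of Theorem 4.4 («the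
dependence in `k` is of the form `αx^{k−1} + (k−1)βx^{k−1}`, `x = −⅓`»); for `k ≥ 1` the pole is a simple
pole of `ρ_p` alone (`a_ℓ = 0`, `B = 0`, `A = ρ_∞^{(m,k)}(0)(1−p⁻¹)/(9 log p)`).
[cite: ConnesConsani2021QuasiInner, Thm 4.4 proof (arXiv chunk p0012:L21–L29), Thm 4.8 proof (p0014:L64)] -/
theorem exists_factorPrime_doublePole_sub {m : ℕ} (hm : 0 < m) (k : ℕ) {p : ℕ} (hp : 1 < p) :
    ∃ A B : ℂ, ∀ ℓ : ℕ, ∃ a : ℂ, ∃ ψ : ℂ → ℂ, ∃ W ∈ 𝓝 (0 : ℂ), DifferentiableOn ℂ ψ W ∧ ψ 0 = 0 ∧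
      ∀ z ∈ W, z ≠ 0 →
        rhoFactor m k z * rhoPrime p z * ((2 * z + 1) ^ ℓ / (2 * z - 3) ^ (ℓ + 2)) - a / z ^ 2 -
            (A + B * ℓ) * (-1 / 3 : ℂ) ^ ℓ / z = ψ z / (z - 0) := by
  rcases Nat.eq_zero_or_pos k with hk0 | hkpos
  · -- `k = 0`: the double pole
    subst hk0
    obtain ⟨g, W, hW, hWball, hg, hF⟩ := fp_exists_eq_div_sq_zero hm hp
    set u₁ : ℂ := deriv cayleyInv 0 with hu₁
    set v₁ : ℂ := deriv (fun w : ℂ => ((2 * w - 3) ^ 2)⁻¹) 0 with hv₁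
    refine ⟨deriv g 0 * (1 / 9) + g 0 * v₁, g 0 * (-3) * u₁ * (1 / 9), fun ℓ => ?_⟩
    set K : ℂ → ℂ := fun w => (2 * w + 1) ^ ℓ / (2 * w - 3) ^ (ℓ + 2) with hK
    set Ψ : ℂ → ℂ := fun w => g w * K w with hΨ
    have hre : ∀ z ∈ W, z.re < 3 / 2 := by
      intro z hz
      have h := hWball hz
      rw [Metric.mem_ball, dist_zero_right] at h
      have := (abs_re_le_norm z).trans_lt h
      linarith [(abs_lt.1 this).2]
    have hΨd : DifferentiableOn ℂ Ψ W := fun z hz =>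
      (hg z hz).mul (fp_differentiableAt_kernel (hre z hz) ℓ).differentiableWithinAt
    have hgd : HasDerivAt g (deriv g 0) 0 := (hg.differentiableAt hW).hasDerivAt
    have hK0 : K 0 = (-1 / 3 : ℂ) ^ ℓ * (1 / 9) := by
      rw [hK]
      dsimp only
      rw [mul_zero, zero_add, one_pow, zero_sub, pow_add, show (-1 / 3 : ℂ) = (-3)⁻¹ by norm_num,
        inv_pow]
      have h3 : (-3 : ℂ) ^ ℓ ≠ 0 := pow_ne_zero _ (by norm_num)
      field_simp
      norm_num
    have hdΨ : HasDerivAt Ψ (deriv g 0 * K 0 + g 0 * ((ℓ : ℂ) * (-1 / 3 : ℂ) ^ ℓ * (-3) *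
        deriv cayleyInv 0 * (1 / 9) + (-1 / 3 : ℂ) ^ ℓ * deriv (fun w : ℂ => ((2 * w - 3) ^ 2)⁻¹) 0)) 0 :=
      hgd.fun_mul (fp_hasDerivAt_kernel_zero ℓ)
    have hΨ' : deriv Ψ 0 = (deriv g 0 * (1 / 9) + g 0 * v₁ + g 0 * (-3) * u₁ * (1 / 9) * ℓ) *
        (-1 / 3 : ℂ) ^ ℓ := by
      rw [hdΨ.deriv, hK0]
      ring
    refine ⟨Ψ 0, fun z => z * dslope (dslope Ψ 0) 0 z, W, hW, ?_, by simp, ?_⟩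
    · have h1 : DifferentiableOn ℂ (dslope Ψ 0) W := (differentiableOn_dslope hW).2 hΨd
      have h2 : DifferentiableOn ℂ (dslope (dslope Ψ 0) 0) W := (differentiableOn_dslope hW).2 h1
      exact (differentiableOn_id.mul h2)
    · intro z hz hz0
      have e1 : z * dslope (dslope Ψ 0) 0 z / (z - 0) = dslope (dslope Ψ 0) 0 z := by
        rw [sub_zero, mul_div_cancel_left₀ _ hz0]
      have e2 : dslope (dslope Ψ 0) 0 z = ((Ψ z - Ψ 0) / z - deriv Ψ 0) / z := by
        rw [dslope_of_ne _ hz0, slope_def_field, dslope_of_ne _ hz0, slope_def_field, dslope_same, sub_zero]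
      have hΨz : Ψ z = g z * ((2 * z + 1) ^ ℓ / (2 * z - 3) ^ (ℓ + 2)) := rfl
      rw [e1, e2, hF ℓ z hz hz0, hΨ', hΨz]
      field_simp
  · -- `k ≥ 1`: a simple pole of `ρ_p` alone
    have hlogR : 0 < Real.log p := Real.log_pos (by exact_mod_cast hp)
    have hG0 : gammaFactor m k 0 ≠ 0 := by
      refine fp_gammaFactor_ne_zero_of_re_ne hm k fun n h => ?_
      simp at h
      have hk1 : (1 : ℝ) ≤ k := by exact_mod_cast hkpos
      have : (0 : ℝ) ≤ m * n := by positivity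
      linarith
    -- `ρ_∞^{(m,k)}` is holomorphic near `0`
    have hρd : DifferentiableAt ℂ (rhoFactor m k) 0 := differentiableAt_rhoFactor hm k hG0
    obtain ⟨ε, hε, hball⟩ : ∃ ε > 0, ∀ z ∈ Metric.ball (0 : ℂ) ε, gammaFactor m k z ≠ 0 := by
      have hcont : ContinuousAt (gammaFactor m k) 0 := by
        have e : gammaFactor m k = fun z => Complex.Gamma (z / (2 * (m : ℂ)) + (k : ℂ) / (m : ℂ)) :=
          funext fun z => gammaFactor_def m k z
        have hpoles : ∀ n : ℕ, (0 : ℂ) / (2 * (m : ℂ)) + (k : ℂ) / (m : ℂ) ≠ -n := by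
          intro n h
          apply hG0
          rw [gammaFactor_def, h, Complex.Gamma_neg_nat_eq_zero]
        rw [e]
        exact ((Complex.differentiableAt_Gamma _ hpoles).comp (0 : ℂ)
          (by fun_prop : DifferentiableAt ℂ (fun z : ℂ => z / (2 * (m : ℂ)) + (k : ℂ) / (m : ℂ)) 0)).continuousAt
      have hne := hcont.eventually_ne hG0
      obtain ⟨ε, hε, hεb⟩ := Metric.eventually_nhds_iff.1 hne
      exact ⟨ε, hε, fun z hz => hεb (by rwa [Metric.mem_ball] at hz)⟩
    refine ⟨rhoFactor m k 0 * ((1 - (p : ℂ)⁻¹) / Real.log p) * (1 / 9), 0, fun ℓ => ?_⟩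
    obtain ⟨ψ₀, V, hV, hd, hval, heq⟩ := exists_pole_structure_rhoPrime_kernel hp ℓ 0
    simp only [Int.cast_zero, mul_zero, zero_div, sub_zero] at hV hd hval heq
    -- `Φ = ρ_∞^{(m,k)} · (−⅛)ψ₀` is holomorphic near `0`, `F_ℓ = Φ/z`
    set W : Set ℂ := Metric.ball (0 : ℂ) (min ε 1) ∩ V with hWdef
    have hW : W ∈ 𝓝 (0 : ℂ) := inter_mem (Metric.ball_mem_nhds _ (lt_min hε one_pos)) hV
    set Φ : ℂ → ℂ := fun w => rhoFactor m k w * (-(1 / 8 : ℂ) * ψ₀ w) with hΦ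
    have hΦd : DifferentiableOn ℂ Φ W := by
      intro w hw
      have hwε : w ∈ Metric.ball (0 : ℂ) ε := Metric.ball_subset_ball (min_le_left _ _) hw.1
      exact ((differentiableAt_rhoFactor hm k (hball w hwε)).differentiableWithinAt).mul
        (((hd w hw.2).const_mul _).mono inter_subset_right)
    have hΦ0 : Φ 0 = (rhoFactor m k 0 * ((1 - (p : ℂ)⁻¹) / Real.log p) * (1 / 9) + 0 * ℓ) *
        (-1 / 3 : ℂ) ^ ℓ := by
      rw [hΦ]
      dsimp only
      rw [hval, cayleyInv_zero]
      ring
    refine ⟨0, fun z => z * dslope Φ 0 z, W, hW, ?_, by simp, ?_⟩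
    · exact differentiableOn_id.mul ((differentiableOn_dslope hW).2 hΦd)
    · intro z hz hz0
      have hF : rhoFactor m k z * rhoPrime p z * ((2 * z + 1) ^ ℓ / (2 * z - 3) ^ (ℓ + 2)) = Φ z / z := by
        have h := heq z hz.2 hz0
        rw [fp_kernel_eq] at h
        have h' : rhoPrime p z * ((2 * z + 1) ^ ℓ / (2 * z - 3) ^ (ℓ + 2)) =
            -(1 / 8 : ℂ) * (ψ₀ z / z) := by
          have e : rhoPrime p z * ((2 * z + 1) ^ ℓ / (2 * z - 3) ^ (ℓ + 2)) =
              -(1 / 8 : ℂ) * (rhoPrime p z * (-8 * ((2 * z + 1) ^ ℓ / (2 * z - 3) ^ (ℓ + 2)))) := by ring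
          rw [e, h]
        rw [mul_assoc, h', hΦ]
        ring
      have e1 : z * dslope Φ 0 z / (z - 0) = dslope Φ 0 z := by
        rw [sub_zero, mul_div_cancel_left₀ _ hz0]
      rw [e1, dslope_of_ne _ hz0, slope_def_field, sub_zero, hF, hΦ0, zero_div, sub_zero]
      field_simp

/-- RH-FREE. `∮_{∂K} a z⁻² dz = 0` over a rectangle containing `0` in its interior. [folklore] -/
private theorem fp_rectBoundaryIntegral_div_sq (c₀ : ℂ) {a b c d : ℝ} (ha : a < 0) (hb : 0 < b)
    (hc : c < 0) (hd : 0 < d) :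
    Literature.Analysis.Complex.rectBoundaryIntegral (fun z : ℂ => c₀ / z ^ 2) a b c d = 0 := by
  have hG : ∀ z : ℂ, z ≠ 0 → HasDerivAt (fun w : ℂ => -c₀ * w⁻¹) (c₀ / z ^ 2) z := by
    intro z hz
    refine ((hasDerivAt_inv hz).const_mul (-c₀)).congr_deriv ?_
    rw [div_eq_mul_inv]
    ring
  have hhor : ∀ y : ℝ, y ≠ 0 → ∫ x in a..b, c₀ / (((x : ℂ) + y * I) ^ 2) =
      -c₀ * ((b : ℂ) + y * I)⁻¹ - -c₀ * ((a : ℂ) + y * I)⁻¹ := by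
    intro y hy
    have hne : ∀ x : ℝ, ((x : ℂ) + y * I) ≠ 0 := by
      intro x h
      have := congrArg Complex.im h
      simp at this
      exact hy this
    apply intervalIntegral.integral_eq_sub_of_hasDerivAt
    · intro x _
      have hpath : HasDerivAt (fun w : ℂ => w + y * I) 1 (x : ℂ) := (hasDerivAt_id' (x : ℂ)).add_const _
      have h1 := HasDerivAt.comp (x : ℂ) (hG ((x : ℂ) + y * I) (hne x)) hpath
      rw [mul_one] at h1
      exact h1.comp_ofReal
    · exact (continuous_const.div (by fun_prop) fun x => pow_ne_zero _ (hne x)).intervalIntegrable _ _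
  have hver : ∀ x : ℝ, x ≠ 0 → I * ∫ y in c..d, c₀ / (((x : ℂ) + y * I) ^ 2) =
      -c₀ * ((x : ℂ) + d * I)⁻¹ - -c₀ * ((x : ℂ) + c * I)⁻¹ := by
    intro x hx
    have hne : ∀ y : ℝ, ((x : ℂ) + y * I) ≠ 0 := by
      intro y h
      have := congrArg Complex.re h
      simp at this
      exact hx this
    rw [← intervalIntegral.integral_const_mul]
    apply intervalIntegral.integral_eq_sub_of_hasDerivAt
    · intro y _
      have hpath : HasDerivAt (fun w : ℂ => (x : ℂ) + w * I) (1 * I) (y : ℂ) :=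
        ((hasDerivAt_id' (y : ℂ)).mul_const I).const_add (x : ℂ)
      have h1 := HasDerivAt.comp (y : ℂ) (hG ((x : ℂ) + y * I) (hne y)) hpath
      have e : c₀ / ((x : ℂ) + y * I) ^ 2 * (1 * I) = I * (c₀ / ((x : ℂ) + y * I) ^ 2) := by ring
      rw [e] at h1
      exact h1.comp_ofReal
    · exact (continuous_const.mul (continuous_const.div (by fun_prop)
        fun y => pow_ne_zero _ (hne y))).intervalIntegrable _ _
  rw [Literature.Analysis.Complex.rectBoundaryIntegral_def, hhor c hc.ne, hhor d hd.ne', hver b hb.ne',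
    hver a ha.ne]
  ring

end DoublePole

/-! ### D. The residue theorem on the rectangles `[½ − 2mj, ½] × [−R_M, R_M]`, `R_M = (2M+1)π/log p` -/

section Rectangle

set_option maxHeartbeats 1600000 in
/-- RH-FREE. **The residue formula on the printed rectangles** for `F_ℓ = ρ_∞^{(m,k)}ρ_p(2z+1)^ℓ(2z−3)^{−ℓ−2}`:
with `R_M = (2M+1)π/log p` («the same choice `R = (2m+1)π/log p` as in the proof of Lemma 3.2») and the
principal part `az⁻² + bz⁻¹` of `F_ℓ` at `0` split off (hypothesis `hab`, supplied by
`exists_factorPrime_doublePole_sub`), the boundary integral over `[½ − 2mj, ½] × [−R_M, R_M]` equals `2πi`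
times (the residues at the poles `−2k−2mn ≠ 0`, `n < j`) + (the residues at `2πin/log p`, `0 < |n| ≤ M`) + `b`.
[cite: ConnesConsani2021QuasiInner, Thm 4.8 proof (arXiv chunk p0014:L64) with Thm 4.4 proof (p0011:L104–p0012:L9)] -/
theorem rectBoundaryIntegral_factorPrime {m : ℕ} (hm : 0 < m) {k : ℕ} (hk : k < m) {p : ℕ} (hp : p.Prime)
    (ℓ : ℕ) {a b : ℂ}
    (hab : ∃ ψ : ℂ → ℂ, ∃ W ∈ 𝓝 (0 : ℂ), DifferentiableOn ℂ ψ W ∧ ψ 0 = 0 ∧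
      ∀ z ∈ W, z ≠ 0 →
        rhoFactor m k z * rhoPrime p z * ((2 * z + 1) ^ ℓ / (2 * z - 3) ^ (ℓ + 2)) - a / z ^ 2 - b / z =
          ψ z / (z - 0))
    {j M : ℕ} (hj : 1 ≤ j) (hM : 1 ≤ M) :
    Literature.Analysis.Complex.rectBoundaryIntegral
        (fun z : ℂ => rhoFactor m k z * rhoPrime p z * ((2 * z + 1) ^ ℓ / (2 * z - 3) ^ (ℓ + 2)))
        (1 / 2 - 2 * m * j) (1 / 2) (-((2 * M + 1) * π / Real.log p)) ((2 * M + 1) * π / Real.log p) =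
      2 * π * I *
        ((∑ n ∈ (Finset.range j).filter (fun n => ¬(k = 0 ∧ n = 0)),
            (2 * (m : ℂ) * ((π : ℂ) / m) ^ (1 / (2 * (m : ℂ)) - (-(2 * (k : ℂ) + 2 * (m : ℂ) * (n : ℂ))) / m) *
          (Complex.Gamma ((1 - (-(2 * (k : ℂ) + 2 * (m : ℂ) * (n : ℂ)))) / (2 * (m : ℂ)) + (k : ℂ) / (m : ℂ)))⁻¹ /
            ((-1) ^ n * (n ! : ℂ))) *
              (rhoPrime p (-(2 * (k : ℂ) + 2 * (m : ℂ) * (n : ℂ))) *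
                ((2 * (-(2 * (k : ℂ) + 2 * (m : ℂ) * (n : ℂ))) + 1) ^ ℓ /
                  (2 * (-(2 * (k : ℂ) + 2 * (m : ℂ) * (n : ℂ))) - 3) ^ (ℓ + 2)))) +
          (∑ n ∈ (Finset.Icc (-(M : ℤ)) M).erase 0,
            rhoFactor m k (2 * π * I * n / Real.log p) * ((1 - (p : ℂ)⁻¹) / Real.log p *
              ((2 * (2 * π * I * n / Real.log p) + 1) ^ ℓ /
                (2 * (2 * π * I * n / Real.log p) - 3) ^ (ℓ + 2)))) + b) := by
  classical
  have hp1 : 1 < p := hp.one_lt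
  have hlogR : 0 < Real.log p := Real.log_pos (by exact_mod_cast hp1)
  have hj1 : (1 : ℝ) ≤ j := by exact_mod_cast hj
  have hM1 : (1 : ℝ) ≤ M := by exact_mod_cast hM
  have hm1 : (1 : ℝ) ≤ m := by exact_mod_cast hm
  have hm0 : (0 : ℝ) < m := by positivity
  set L : ℝ := Real.log p with hL
  set R : ℝ := (2 * M + 1) * π / L with hR
  set R' : ℝ := 2 * π * (M + 1) / L with hR'
  have hR0 : 0 < R := by positivity
  have hRR' : R < R' := by
    rw [hR, hR', div_lt_div_iff_of_pos_right hlogR]; nlinarith [Real.pi_pos]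
  set aj : ℝ := 1 / 2 - 2 * m * j with haj
  have hmj : (1 : ℝ) ≤ (m : ℝ) * j := by nlinarith
  have haj0 : aj < 0 := by rw [haj]; linarith
  have hab' : aj < 1 / 2 := by linarith
  have hcd : -R < R := by linarith
  -- the integrand, the principal part at `0`, the corrected integrand
  set K : ℂ → ℂ := fun z => (2 * z + 1) ^ ℓ / (2 * z - 3) ^ (ℓ + 2) with hK
  set F : ℂ → ℂ := fun z => rhoFactor m k z * rhoPrime p z * K z with hF
  set Q : ℂ → ℂ := fun z => a / z ^ 2 + b / z with hQ
  set G : ℂ → ℂ := fun z => F z - a / z ^ 2 - b / z with hG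
  -- the poles
  set zP : ℤ → ℂ := fun n => 2 * π * I * n / L with hzP
  have hzP_im : ∀ n : ℤ, (zP n).im = 2 * π * n / L := fun n => by
    rw [hzP]; dsimp only; rw [Complex.div_ofReal_im]; simp
  have hzP_re : ∀ n : ℤ, (zP n).re = 0 := fun n => by
    rw [hzP]; dsimp only; rw [Complex.div_ofReal_re]; simp
  have hzP_inj : Function.Injective zP := by
    intro u v h
    have := congrArg Complex.im h
    rw [hzP_im, hzP_im, div_left_inj' hlogR.ne'] at this
    have h2 : (u : ℝ) = v := by nlinarith [Real.pi_pos]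
    exact_mod_cast h2
  have hzP_im_ne : ∀ n : ℤ, n ≠ 0 → (zP n).im ≠ 0 := by
    intro n hn
    rw [hzP_im]
    have : (n : ℝ) ≠ 0 := by exact_mod_cast hn
    exact div_ne_zero (mul_ne_zero (mul_ne_zero two_ne_zero Real.pi_ne_zero) this) hlogR.ne'
  have hzP_ne : ∀ n : ℤ, n ≠ 0 → zP n ≠ 0 := by
    intro n hn h
    exact hzP_im_ne n hn (by rw [h]; simp)
  set zA : ℕ → ℂ := fun n => -(2 * (k : ℂ) + 2 * (m : ℂ) * (n : ℂ)) with hzA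
  have hzA_re : ∀ n : ℕ, (zA n).re = -(2 * k + 2 * m * n) := fun n => by rw [hzA]; simp
  have hzA_im : ∀ n : ℕ, (zA n).im = 0 := fun n => by rw [hzA]; simp
  have hzA_inj : Function.Injective zA := by
    intro u v h
    have := congrArg Complex.re h
    rw [hzA_re, hzA_re] at this
    have h' : (m : ℝ) * u = m * v := by linarith
    exact_mod_cast mul_left_cancel₀ hm0.ne' h'
  have hzA_ne : ∀ n : ℕ, ¬(k = 0 ∧ n = 0) → zA n ≠ 0 := by
    intro n hn h
    have := congrArg Complex.re h
    rw [hzA_re] at this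
    simp at this
    have h2 : (2 * k + 2 * m * n : ℝ) = 0 := by linarith
    have h3 : 2 * k + 2 * m * n = 0 := by exact_mod_cast h2
    rcases Nat.eq_zero_or_pos n with h0 | hpos
    · exact hn ⟨by omega, h0⟩
    · have : 0 < 2 * m * n := by positivity
      omega
  set IA : Finset ℕ := (Finset.range j).filter (fun n => ¬(k = 0 ∧ n = 0)) with hIA
  set SA : Finset ℂ := IA.image zA with hSA
  set SP : Finset ℂ := ((Finset.Icc (-(M : ℤ)) M).erase 0).image zP with hSP
  set S : Finset ℂ := SA ∪ SP ∪ {0} with hS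
  -- the residues, as a function of the pole
  set idx : ℂ → ℕ := fun q => ⌊(-q.re - 2 * k) / (2 * m)⌋₊ with hidx
  have hidxA : ∀ n : ℕ, idx (zA n) = n := by
    intro n
    rw [hidx]
    dsimp only
    rw [hzA_re, neg_neg, show ((2 * k + 2 * m * n : ℝ) - 2 * k) / (2 * m) = n by field_simp; ring,
      Nat.floor_natCast]
  set r : ℂ → ℂ := fun q => if q = 0 then 0 else if q.im = 0 then
      (2 * (m : ℂ) * ((π : ℂ) / m) ^ (1 / (2 * (m : ℂ)) - (-(2 * (k : ℂ) + 2 * (m : ℂ) * (idx q : ℂ))) / m) *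
          (Complex.Gamma ((1 - (-(2 * (k : ℂ) + 2 * (m : ℂ) * (idx q : ℂ)))) / (2 * (m : ℂ)) + (k : ℂ) / (m : ℂ)))⁻¹ /
            ((-1) ^ (idx q) * ((idx q) ! : ℂ))) * (rhoPrime p q * K q)
      else rhoFactor m k q * ((1 - (p : ℂ)⁻¹) / L * K q) with hr
  have hrA : ∀ n : ℕ, ¬(k = 0 ∧ n = 0) → r (zA n) = (2 * (m : ℂ) * ((π : ℂ) / m) ^ (1 / (2 * (m : ℂ)) - (-(2 * (k : ℂ) + 2 * (m : ℂ) * (n : ℂ))) / m) *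
          (Complex.Gamma ((1 - (-(2 * (k : ℂ) + 2 * (m : ℂ) * (n : ℂ)))) / (2 * (m : ℂ)) + (k : ℂ) / (m : ℂ)))⁻¹ /
            ((-1) ^ n * (n ! : ℂ))) * (rhoPrime p (zA n) * K (zA n)) := by
    intro n hn
    rw [hr]
    dsimp only
    rw [if_neg (hzA_ne n hn), if_pos (hzA_im n), hidxA n]
  have hrP : ∀ n : ℤ, n ≠ 0 → r (zP n) = rhoFactor m k (zP n) * ((1 - (p : ℂ)⁻¹) / L * K (zP n)) := by
    intro n hn
    rw [hr]
    dsimp only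
    rw [if_neg (hzP_ne n hn), if_neg (hzP_im_ne n hn)]
  have hr0 : r 0 = 0 := by rw [hr]; simp
  -- the open set `U` and the rectangle
  set U : Set ℂ := Ioo (1 / 4 - 2 * (m : ℝ) * j) 1 ×ℂ Ioo (-R') R' with hU
  have hUo : IsOpen U := isOpen_Ioo.reProdIm isOpen_Ioo
  have hKU : Icc aj (1 / 2) ×ℂ Icc (-R) R ⊆ U := by
    intro z hz
    rw [mem_reProdIm] at hz ⊢
    exact ⟨⟨by rw [haj] at hz; linarith [hz.1.1], by linarith [hz.1.2]⟩,
      ⟨by linarith [hz.2.1], by linarith [hz.2.2]⟩⟩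
  -- the poles are inside
  have hSA_sub : (SA : Set ℂ) ⊆ Ioo aj (1 / 2) ×ℂ Ioo (-R) R := by
    intro z hz
    rw [hSA, Finset.coe_image] at hz
    obtain ⟨n, hn, rfl⟩ := hz
    rw [hIA, Finset.coe_filter] at hn
    have hnj : (n : ℝ) + 1 ≤ j := by exact_mod_cast Finset.mem_range.1 hn.1
    have hkm : (k : ℝ) + 1 ≤ m := by exact_mod_cast hk
    rw [mem_reProdIm, hzA_re, hzA_im, haj]
    refine ⟨⟨?_, ?_⟩, ⟨by linarith, by linarith⟩⟩
    · have : (2 * k + 2 * m * n : ℝ) ≤ 2 * m * j - 2 := by nlinarith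
      linarith
    · have : (0 : ℝ) ≤ 2 * k + 2 * m * n := by positivity
      linarith
  have hSP_sub : (SP : Set ℂ) ⊆ Ioo aj (1 / 2) ×ℂ Ioo (-R) R := by
    intro z hz
    rw [hSP, Finset.coe_image] at hz
    obtain ⟨n, hn, rfl⟩ := hz
    have hn1 := Finset.mem_Icc.1 (Finset.mem_erase.1 (Finset.mem_coe.1 hn)).2
    have hn' : |(n : ℝ)| ≤ M := by
      rw [← Int.cast_abs]; exact_mod_cast abs_le.2 hn1
    rw [mem_reProdIm, hzP_re, hzP_im]
    refine ⟨⟨haj0, by norm_num⟩, ?_⟩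
    rw [mem_Ioo, hR, neg_lt, lt_div_iff₀ hlogR, ← neg_div, div_mul_cancel₀ _ hlogR.ne',
      div_lt_div_iff_of_pos_right hlogR]
    constructor <;> nlinarith [abs_le.1 hn', Real.pi_pos]
  have hSsub : (S : Set ℂ) ⊆ Ioo aj (1 / 2) ×ℂ Ioo (-R) R := by
    intro z hz
    rw [hS, Finset.coe_union, Finset.coe_union, Finset.coe_singleton] at hz
    rcases hz with (hz | hz) | hz
    · exact hSA_sub hz
    · exact hSP_sub hz
    · rw [mem_singleton_iff] at hz
      rw [hz, mem_reProdIm]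
      simp only [zero_re, zero_im, mem_Ioo]
      exact ⟨⟨haj0, by norm_num⟩, ⟨by linarith, hR0⟩⟩
  -- `F` is differentiable at the points of `U` that are not poles; so is `G`
  have hFdiff : ∀ z ∈ U, z ∉ (S : Set ℂ) → DifferentiableAt ℂ F z := by
    intro z hzU hzS
    rw [hU, mem_reProdIm] at hzU
    have hz0 : z ≠ 0 := by
      intro h; apply hzS; rw [h, hS]; simp
    have hGam : gammaFactor m k z ≠ 0 := by
      intro h
      obtain ⟨n, hn⟩ := (gammaFactor_eq_zero_iff hm k z).1 h
      have hzn : z = zA n := by rw [hn, hzA]; ring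
      by_cases hnj : n < j
      · by_cases hkn : k = 0 ∧ n = 0
        · apply hz0
          rw [hzn, hzA]
          simp [hkn.1, hkn.2]
        · apply hzS
          rw [hS, Finset.coe_union, Finset.coe_union]
          left; left
          rw [hSA, Finset.coe_image]
          exact ⟨n, by rw [hIA, Finset.coe_filter]; exact ⟨Finset.mem_range.2 hnj, hkn⟩, hzn.symm⟩
      · have : (j : ℝ) ≤ n := by exact_mod_cast not_lt.1 hnj
        have hre : z.re = -(2 * k + 2 * m * n) := by rw [hzn, hzA_re]
        have : (2 * (m : ℝ)) * j ≤ 2 * m * n := by nlinarith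
        have hk0 : (0 : ℝ) ≤ k := k.cast_nonneg
        linarith [hzU.1.1]
    have hlat : ∀ q : ℤ, z ≠ 2 * π * I * q / Real.log p := by
      intro q hq
      have him : |2 * π * q / L| < R' := by
        have := hzU.2
        rw [hq, show (2 * π * I * q / Real.log p : ℂ).im = 2 * π * q / L from hzP_im q] at this
        exact abs_lt.2 this
      have hq' : |(q : ℝ)| < M + 1 := by
        rw [abs_div, abs_of_pos hlogR, hR', div_lt_div_iff_of_pos_right hlogR, abs_mul,
          abs_of_pos (by positivity : (0:ℝ) < 2 * π)] at him
        nlinarith [Real.pi_pos, abs_nonneg (q : ℝ)]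
      have hqM : |q| ≤ (M : ℤ) := by
        have : |(q : ℝ)| < (M : ℤ) + 1 := by push_cast; exact hq'
        rw [← Int.cast_abs] at this
        exact Int.lt_add_one_iff.1 (by exact_mod_cast this)
      rcases eq_or_ne q 0 with hq0 | hq0
      · apply hz0; rw [hq, hq0]; simp
      · apply hzS
        rw [hS, Finset.coe_union, Finset.coe_union]
        left; right
        rw [hSP, Finset.coe_image]
        refine ⟨q, ?_, hq.symm⟩
        rw [Finset.coe_erase, Finset.coe_Icc]
        exact ⟨abs_le.1 hqM, hq0⟩
    exact ((differentiableAt_rhoFactor hm k hGam).mul (fp_differentiableAt_rhoPrime' hp1 hlat)).mul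
      (fp_differentiableAt_kernel (by linarith [hzU.1.2]) ℓ)
  have hQa : ∀ z : ℂ, z ≠ 0 → DifferentiableAt ℂ (fun w : ℂ => a / w ^ 2) z := by
    intro z hz
    exact DifferentiableAt.div (c := fun _ : ℂ => a) (d := fun w : ℂ => w ^ 2) (differentiableAt_const _)
      (differentiableAt_pow 2) (pow_ne_zero _ hz)
  have hQb : ∀ z : ℂ, z ≠ 0 → DifferentiableAt ℂ (fun w : ℂ => b / w) z := by
    intro z hz
    exact DifferentiableAt.div (c := fun _ : ℂ => b) (d := fun w : ℂ => w) (differentiableAt_const _)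
      differentiableAt_id hz
  have hQdiff : ∀ z : ℂ, z ≠ 0 → DifferentiableAt ℂ Q z := by
    intro z hz
    rw [hQ]
    exact (hQa z hz).add (hQb z hz)
  have hGQ : ∀ z : ℂ, G z = F z - Q z := by intro z; rw [hG, hQ]; dsimp only; ring
  have hG_of : ∀ z : ℂ, z ≠ 0 → DifferentiableAt ℂ F z → DifferentiableAt ℂ G z := by
    intro z hz hFz
    have : G = fun w => F w - Q w := funext hGQ
    rw [this]
    exact hFz.sub (hQdiff z hz)
  have hGdiff : DifferentiableOn ℂ G (U \ ↑S) := by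
    intro z hz
    have hz0 : z ≠ 0 := by
      intro h; apply hz.2; rw [h, hS]; simp
    exact (hG_of z hz0 (hFdiff z hz.1 hz.2)).differentiableWithinAt
  -- the pole structure of `G`
  have hpole : ∀ q ∈ S, ∃ φ_ : ℂ → ℂ, ∃ V ∈ 𝓝 q, DifferentiableOn ℂ φ_ V ∧ φ_ q = r q ∧
      ∀ z ∈ V, z ≠ q → G z = φ_ z / (z - q) := by
    intro q hq
    rw [hS, Finset.mem_union, Finset.mem_union] at hq
    rcases hq with (hq | hq) | hq
    · -- a pole `−2k−2mn` of `ρ_∞^{(m,k)}`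
      rw [hSA, Finset.mem_image] at hq
      obtain ⟨n, hn, rfl⟩ := hq
      rw [hIA, Finset.mem_filter] at hn
      obtain ⟨ψ, hψd, hψv, hψeq⟩ := exists_factorPrime_eq_div_sub_archPole hm k hp1 ℓ hn.2
      have e : (-(2 * (k : ℂ) + 2 * (m : ℂ) * (n : ℂ))) = zA n := rfl
      rw [e] at hψd hψv hψeq
      have hball0 : ∀ z ∈ Metric.ball (zA n) 1, z ≠ 0 := by
        intro z hz h
        rw [h, Metric.mem_ball, dist_eq_norm, zero_sub, norm_neg] at hz
        have h1 : |(zA n).re| ≤ ‖zA n‖ := abs_re_le_norm _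
        rw [hzA_re, abs_neg, abs_of_nonneg (by positivity)] at h1
        -- `2k + 2mn ≥ 2` since `(k, n) ≠ (0, 0)`
        have h2 : (2 : ℝ) ≤ 2 * k + 2 * m * n := by
          rcases Nat.eq_zero_or_pos n with h0 | hpos
          · have hk1 : k ≠ 0 := fun h' => hn.2 ⟨h', h0⟩
            have : (1 : ℝ) ≤ k := by exact_mod_cast Nat.one_le_iff_ne_zero.2 hk1
            have : (0 : ℝ) ≤ m * n := by positivity
            linarith
          · have : (1 : ℝ) ≤ n := by exact_mod_cast hpos
            have hk0 : (0 : ℝ) ≤ k := k.cast_nonneg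
            nlinarith
        linarith
      refine ⟨fun z => ψ z - Q z * (z - zA n), Metric.ball (zA n) 1, Metric.ball_mem_nhds _ one_pos,
        ?_, ?_, ?_⟩
      · intro z hz
        exact (hψd z hz).sub (((hQdiff z (hball0 z hz)).mul
          (differentiableAt_id.sub (differentiableAt_const _))).differentiableWithinAt)
      · simp only [sub_self, mul_zero, sub_zero]
        rw [hrA n hn.2, hψv]
      · intro z hz hzq
        have hzq' : z - zA n ≠ 0 := sub_ne_zero.2 hzq
        rw [hGQ, hF]
        dsimp only
        rw [hψeq z hz hzq]
        field_simp
    · -- a pole `2πin/log p` of `ρ_p`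
      rw [hSP, Finset.mem_image] at hq
      obtain ⟨n, hn, rfl⟩ := hq
      rw [Finset.mem_erase] at hn
      obtain ⟨ψ, V, hV, hψd, hψv, hψeq⟩ := exists_factorPrime_eq_div_sub_primePole hm k hp1 ℓ hn.1
      have e : (2 * π * I * n / Real.log p : ℂ) = zP n := rfl
      rw [e] at hV hψv hψeq
      have hW : {w : ℂ | w ≠ 0} ∈ 𝓝 (zP n) := isOpen_ne.mem_nhds (hzP_ne n hn.1)
      refine ⟨fun z => ψ z - Q z * (z - zP n), V ∩ {w : ℂ | w ≠ 0}, inter_mem hV hW, ?_, ?_, ?_⟩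
      · intro z hz
        exact ((hψd z hz.1).mono inter_subset_left).sub (((hQdiff z hz.2).mul
          (differentiableAt_id.sub (differentiableAt_const _))).differentiableWithinAt)
      · simp only [sub_self, mul_zero, sub_zero]
        rw [hrP n hn.1, hψv]
      · intro z hz hzq
        have hzq' : z - zP n ≠ 0 := sub_ne_zero.2 hzq
        rw [hGQ, hF]
        dsimp only
        rw [hψeq z hz.1 hzq]
        field_simp
    · -- the pole at `0`, split off
      rw [Finset.mem_singleton] at hq
      subst hq
      obtain ⟨ψ, W, hW, hψd, hψ0, hψeq⟩ := hab
      refine ⟨ψ, W, hW, hψd, by rw [hψ0, hr0], ?_⟩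
      intro z hz hz0
      rw [hG]
      exact hψeq z hz hz0
  -- the residue theorem for `G`
  have key := Literature.Analysis.Complex.rectBoundaryIntegral_eq_sum_of_simplePoles hab' hcd S G r U
    hUo hKU hSsub hGdiff hpole
  -- continuity on the boundary (no pole there)
  have hbdry : ∀ z : ℂ, (z.re = aj ∨ z.re = 1 / 2 ∨ |z.im| = R) → z.re ∈ Icc aj (1 / 2) →
      |z.im| ≤ R → z ≠ 0 ∧ DifferentiableAt ℂ F z := by
    intro z hz hzre hzim
    have hzU : z ∈ U := hKU (by
      rw [mem_reProdIm, mem_Icc]; exact ⟨hzre, abs_le.1 hzim⟩)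
    have hzS : z ∉ (S : Set ℂ) := by
      intro h
      have h' := hSsub h
      rw [mem_reProdIm, mem_Ioo, mem_Ioo] at h'
      rcases hz with hz | hz | hz
      · linarith [h'.1.1]
      · linarith [h'.1.2]
      · have := abs_lt.2 ⟨h'.2.1, h'.2.2⟩; linarith
    have hz0 : z ≠ 0 := by
      intro h; apply hzS; rw [h, hS]; simp
    exact ⟨hz0, hFdiff z hzU hzS⟩
  have hcontF : ∀ z : ℂ, (z.re = aj ∨ z.re = 1 / 2 ∨ |z.im| = R) → z.re ∈ Icc aj (1 / 2) →
      |z.im| ≤ R → ContinuousAt F z := fun z h1 h2 h3 => (hbdry z h1 h2 h3).2.continuousAt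
  have hcontQ : ∀ z : ℂ, (z.re = aj ∨ z.re = 1 / 2 ∨ |z.im| = R) → z.re ∈ Icc aj (1 / 2) →
      |z.im| ≤ R → ContinuousAt Q z := fun z h1 h2 h3 => (hQdiff z (hbdry z h1 h2 h3).1).continuousAt
  have hcontG : ∀ z : ℂ, (z.re = aj ∨ z.re = 1 / 2 ∨ |z.im| = R) → z.re ∈ Icc aj (1 / 2) →
      |z.im| ≤ R → ContinuousAt G z := by
    intro z h1 h2 h3
    have : G = fun w => F w - Q w := funext hGQ
    rw [this]
    exact (hcontF z h1 h2 h3).sub (hcontQ z h1 h2 h3)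
  -- points of the four sides
  have hreim : ∀ x y : ℝ, ((x : ℂ) + y * I).re = x ∧ ((x : ℂ) + y * I).im = y := by
    intro x y; constructor <;> simp
  have hbot : ∀ x ∈ Icc aj (1 / 2), ((x : ℂ) + (-R : ℝ) * I).re ∈ Icc aj (1 / 2) ∧
      |((x : ℂ) + (-R : ℝ) * I).im| ≤ R ∧ |((x : ℂ) + (-R : ℝ) * I).im| = R := by
    intro x hx
    rw [(hreim x (-R)).1, (hreim x (-R)).2, abs_neg, abs_of_pos hR0]
    exact ⟨hx, le_rfl, rfl⟩
  have htop : ∀ x ∈ Icc aj (1 / 2), ((x : ℂ) + (R : ℝ) * I).re ∈ Icc aj (1 / 2) ∧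
      |((x : ℂ) + (R : ℝ) * I).im| ≤ R ∧ |((x : ℂ) + (R : ℝ) * I).im| = R := by
    intro x hx
    rw [(hreim x R).1, (hreim x R).2, abs_of_pos hR0]
    exact ⟨hx, le_rfl, rfl⟩
  have hleft : ∀ y ∈ Icc (-R) R, ((aj : ℂ) + y * I).re ∈ Icc aj (1 / 2) ∧
      |((aj : ℂ) + y * I).im| ≤ R ∧ ((aj : ℂ) + y * I).re = aj := by
    intro y hy
    rw [(hreim aj y).1, (hreim aj y).2]
    exact ⟨⟨le_rfl, hab'.le⟩, abs_le.2 ⟨hy.1, hy.2⟩, rfl⟩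
  have hright : ∀ y ∈ Icc (-R) R, ((((1 / 2 : ℝ)) : ℂ) + y * I).re ∈ Icc aj (1 / 2) ∧
      |((((1 / 2 : ℝ)) : ℂ) + y * I).im| ≤ R ∧ ((((1 / 2 : ℝ)) : ℂ) + y * I).re = 1 / 2 := by
    intro y hy
    rw [(hreim (1 / 2) y).1, (hreim (1 / 2) y).2]
    exact ⟨⟨hab'.le, le_rfl⟩, abs_le.2 ⟨hy.1, hy.2⟩, rfl⟩
  -- `∮F = ∮G + ∮Q`, `∮Q = ∮az⁻² + ∮bz⁻¹ = 0 + 2πib`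
  have hFGQ : F = fun z => G z + Q z := by
    funext z; rw [hGQ]; ring
  have hsplit1 := Literature.Analysis.Complex.rectBoundaryIntegral_add (F := G) (G := Q) hab'.le hcd.le
    (fun x hx => hcontG _ (Or.inr (Or.inr (hbot x hx).2.2)) (hbot x hx).1 (hbot x hx).2.1)
    (fun x hx => hcontG _ (Or.inr (Or.inr (htop x hx).2.2)) (htop x hx).1 (htop x hx).2.1)
    (fun y hy => hcontG _ (Or.inl (hleft y hy).2.2) (hleft y hy).1 (hleft y hy).2.1)
    (fun y hy => hcontG _ (Or.inr (Or.inl (hright y hy).2.2)) (hright y hy).1 (hright y hy).2.1)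
    (fun x hx => hcontQ _ (Or.inr (Or.inr (hbot x hx).2.2)) (hbot x hx).1 (hbot x hx).2.1)
    (fun x hx => hcontQ _ (Or.inr (Or.inr (htop x hx).2.2)) (htop x hx).1 (htop x hx).2.1)
    (fun y hy => hcontQ _ (Or.inl (hleft y hy).2.2) (hleft y hy).1 (hleft y hy).2.1)
    (fun y hy => hcontQ _ (Or.inr (Or.inl (hright y hy).2.2)) (hright y hy).1 (hright y hy).2.1)
  have hQ1 : ∀ z : ℂ, z ≠ 0 → ContinuousAt (fun w : ℂ => a / w ^ 2) z := fun z hz =>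
    (hQa z hz).continuousAt
  have hQ2 : ∀ z : ℂ, z ≠ 0 → ContinuousAt (fun w : ℂ => b / w) z := fun z hz =>
    (hQb z hz).continuousAt
  have hsplit2 := Literature.Analysis.Complex.rectBoundaryIntegral_add (F := fun w : ℂ => a / w ^ 2)
    (G := fun w : ℂ => b / w) hab'.le hcd.le
    (fun x hx => hQ1 _ (hbdry _ (Or.inr (Or.inr (hbot x hx).2.2)) (hbot x hx).1 (hbot x hx).2.1).1)
    (fun x hx => hQ1 _ (hbdry _ (Or.inr (Or.inr (htop x hx).2.2)) (htop x hx).1 (htop x hx).2.1).1)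
    (fun y hy => hQ1 _ (hbdry _ (Or.inl (hleft y hy).2.2) (hleft y hy).1 (hleft y hy).2.1).1)
    (fun y hy => hQ1 _ (hbdry _ (Or.inr (Or.inl (hright y hy).2.2)) (hright y hy).1 (hright y hy).2.1).1)
    (fun x hx => hQ2 _ (hbdry _ (Or.inr (Or.inr (hbot x hx).2.2)) (hbot x hx).1 (hbot x hx).2.1).1)
    (fun x hx => hQ2 _ (hbdry _ (Or.inr (Or.inr (htop x hx).2.2)) (htop x hx).1 (htop x hx).2.1).1)
    (fun y hy => hQ2 _ (hbdry _ (Or.inl (hleft y hy).2.2) (hleft y hy).1 (hleft y hy).2.1).1)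
    (fun y hy => hQ2 _ (hbdry _ (Or.inr (Or.inl (hright y hy).2.2)) (hright y hy).1 (hright y hy).2.1).1)
  have hQsum : (Q : ℂ → ℂ) = fun w => a / w ^ 2 + b / w := by rw [hQ]
  have hinvsq := fp_rectBoundaryIntegral_div_sq a haj0 (by norm_num : (0:ℝ) < 1 / 2) (neg_lt_zero.2 hR0) hR0
  have hinv : Literature.Analysis.Complex.rectBoundaryIntegral (fun w : ℂ => b / w) aj (1 / 2) (-R) R =
      2 * π * I * b := by
    have e : (fun w : ℂ => b / w) = fun w => b * (w - 0)⁻¹ := by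
      funext w; rw [sub_zero, div_eq_mul_inv]
    rw [e]
    exact Literature.Analysis.Complex.rectBoundaryIntegral_const_mul_inv_sub b 0
      (by simp; exact haj0) (by simp) (by simp; exact hR0) (by simp; exact hR0)
  rw [hFGQ, hsplit1, key, hQsum, hsplit2, hinvsq, hinv, zero_add]
  -- the sum of the residues
  have hdisj1 : Disjoint SA SP := by
    rw [Finset.disjoint_left]
    intro z hz1 hz2
    rw [hSA, Finset.mem_image] at hz1
    rw [hSP, Finset.mem_image] at hz2
    obtain ⟨n, -, rfl⟩ := hz1
    obtain ⟨q, hq, hq'⟩ := hz2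
    rw [Finset.mem_erase] at hq
    have := congrArg Complex.im hq'
    rw [hzA_im] at this
    exact hzP_im_ne q hq.1 this
  have hdisj2 : Disjoint (SA ∪ SP) {0} := by
    rw [Finset.disjoint_singleton_right, Finset.mem_union, not_or]
    constructor
    · rw [hSA, Finset.mem_image]
      rintro ⟨n, hn, h⟩
      rw [hIA, Finset.mem_filter] at hn
      exact hzA_ne n hn.2 h
    · rw [hSP, Finset.mem_image]
      rintro ⟨n, hn, h⟩
      rw [Finset.mem_erase] at hn
      exact hzP_ne n hn.1 h
  rw [hS, Finset.sum_union hdisj2, Finset.sum_union hdisj1, Finset.sum_singleton, hr0, add_zero,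
    hSA, Finset.sum_image fun u _ v _ h => hzA_inj h, hSP, Finset.sum_image fun u _ v _ h => hzP_inj h,
    Finset.sum_congr rfl fun n hn => hrA n (by rw [hIA, Finset.mem_filter] at hn; exact hn.2),
    Finset.sum_congr rfl fun n hn => hrP n (Finset.mem_erase.1 hn).1]
  ring

end Rectangle

/-! ### E. Letting `M → ∞` (fixed width `2mj`): the strip identity with the full series of `ρ_p`-residues -/

section StripLimit

/-- RH-FREE. `|2z − 3|² = (2 Re z − 3)² + 4 (Im z)²`. [folklore] -/
private theorem fp_normSq_two_mul_sub_three (z : ℂ) :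
    ‖2 * z - 3‖ ^ 2 = (2 * z.re - 3) ^ 2 + 4 * z.im ^ 2 := by
  rw [Complex.sq_norm, normSq_apply]
  simp
  ring

/-- RH-FREE. For `Re z ≤ ½`: `|2z − 3|² ≥ 4(1 + (Im z)²)`. [folklore] -/
private theorem fp_four_mul_le_normSq {z : ℂ} (hz : z.re ≤ 1 / 2) : 4 * (1 + z.im ^ 2) ≤ ‖2 * z - 3‖ ^ 2 := by
  rw [fp_normSq_two_mul_sub_three]
  nlinarith

/-- RH-FREE. The pointwise bound `|F_ℓ(z)| ≤ |ρ_∞^{(m,k)}(z)||ρ_p(z)|/|2z−3|²` on `Re z ≤ ½`. [folklore] -/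
private theorem fp_norm_F_le {m k p : ℕ} (ℓ : ℕ) {z : ℂ} (hz : z.re ≤ 1 / 2) :
    ‖rhoFactor m k z * rhoPrime p z * ((2 * z + 1) ^ ℓ / (2 * z - 3) ^ (ℓ + 2))‖ ≤
      ‖rhoFactor m k z‖ * ‖rhoPrime p z‖ * (‖2 * z - 3‖ ^ 2)⁻¹ := by
  rw [norm_mul, norm_mul]
  exact mul_le_mul_of_nonneg_left (norm_ratFactor_le hz ℓ) (by positivity)

/-- RH-FREE. `F_ℓ` is continuous along a vertical line `Re z = c ≤ ½` avoiding the poles, `c ≠ 0`. [folklore] -/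
private theorem fp_continuous_F_vertical {m : ℕ} (hm : 0 < m) (k : ℕ) {p : ℕ} (hp : 1 < p) (ℓ : ℕ) {c : ℝ}
    (hc : ∀ n : ℕ, c ≠ -(2 * k + 2 * m * n)) (hc0 : c ≠ 0) (hc1 : c ≤ 1 / 2) :
    Continuous fun y : ℝ => rhoFactor m k ((c : ℂ) + y * I) * rhoPrime p ((c : ℂ) + y * I) *
      ((2 * ((c : ℂ) + y * I) + 1) ^ ℓ / (2 * ((c : ℂ) + y * I) - 3) ^ (ℓ + 2)) := by
  refine continuous_iff_continuousAt.2 fun y => ?_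
  have hG : gammaFactor m k ((c : ℂ) + y * I) ≠ 0 :=
    fp_gammaFactor_ne_zero_of_re_ne hm k fun n => by simpa using hc n
  have hre : ((c : ℂ) + y * I).re ≠ 0 := by simp; exact hc0
  have hre' : ((c : ℂ) + y * I).re < 3 / 2 := by simp; linarith
  have hline : Continuous fun y : ℝ => (c : ℂ) + y * I := by fun_prop
  exact ContinuousAt.comp
    (g := fun w : ℂ => rhoFactor m k w * rhoPrime p w * ((2 * w + 1) ^ ℓ / (2 * w - 3) ^ (ℓ + 2)))
    (f := fun y : ℝ => (c : ℂ) + y * I) (x := y) (fp_differentiableAt_F hm k hp ℓ hG hre hre').continuousAt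
    hline.continuousAt

/-- RH-FREE. Integrability of `F_ℓ` along a vertical line `Re z = c ≤ ½` (no pole on it) on which
`|ρ_∞^{(m,k)}ρ_p| ≤ B`. [folklore] -/
private theorem fp_integrable_F_vertical {m : ℕ} (hm : 0 < m) (k : ℕ) {p : ℕ} (hp : 1 < p) (ℓ : ℕ)
    {c B : ℝ} (hc : ∀ n : ℕ, c ≠ -(2 * k + 2 * m * n)) (hc0 : c ≠ 0) (hc1 : c ≤ 1 / 2)
    (hB : ∀ y : ℝ, ‖rhoFactor m k ((c : ℂ) + y * I)‖ * ‖rhoPrime p ((c : ℂ) + y * I)‖ ≤ B) :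
    Integrable fun y : ℝ => rhoFactor m k ((c : ℂ) + y * I) * rhoPrime p ((c : ℂ) + y * I) *
      ((2 * ((c : ℂ) + y * I) + 1) ^ ℓ / (2 * ((c : ℂ) + y * I) - 3) ^ (ℓ + 2)) := by
  have hB0 : 0 ≤ B := le_trans (by positivity) (hB 0)
  refine Integrable.mono' (integrable_inv_one_add_sq.const_mul (B / 4))
    (fp_continuous_F_vertical hm k hp ℓ hc hc0 hc1).aestronglyMeasurable (Eventually.of_forall fun y => ?_)
  have hre : ((c : ℂ) + y * I).re ≤ 1 / 2 := by simpa using hc1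
  have h4 := fp_four_mul_le_normSq hre
  simp only [add_im, ofReal_im, mul_im, ofReal_re, I_im, mul_one, I_re, mul_zero, add_zero, zero_add] at h4
  calc ‖rhoFactor m k ((c : ℂ) + y * I) * rhoPrime p ((c : ℂ) + y * I) *
        ((2 * ((c : ℂ) + y * I) + 1) ^ ℓ / (2 * ((c : ℂ) + y * I) - 3) ^ (ℓ + 2))‖
      ≤ ‖rhoFactor m k ((c : ℂ) + y * I)‖ * ‖rhoPrime p ((c : ℂ) + y * I)‖ *
          (‖2 * ((c : ℂ) + y * I) - 3‖ ^ 2)⁻¹ := fp_norm_F_le ℓ hre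
    _ ≤ B * (4 * (1 + y ^ 2))⁻¹ :=
        mul_le_mul (hB y) (inv_anti₀ (by positivity) h4) (by positivity) hB0
    _ = B / 4 * (1 + y ^ 2)⁻¹ := by rw [mul_inv]; ring

/-- RH-FREE. **The residues at the poles of `ρ_p` are absolutely summable** (`|ρ_∞^{(m,k)}(2πin/log p)|` is
bounded — indeed `O(|n|^{−1/(2m)})`, Lemma 4.6 (i) — and `|K_ℓ(2πin/log p)| = O(n^{−2})`).
[cite: ConnesConsani2021QuasiInner, Thm 4.8 proof (arXiv chunk p0014:L64) with Thm 4.4 proof (p0012:L9–L18)] -/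
theorem summable_factorPrime_primeResidues {m : ℕ} (hm : 0 < m) (k : ℕ) {p : ℕ} (hp : 1 < p) (ℓ : ℕ) :
    Summable fun n : ℤ => if n = 0 then (0 : ℂ) else
      rhoFactor m k (2 * π * I * n / Real.log p) * ((1 - (p : ℂ)⁻¹) / Real.log p *
        ((2 * (2 * π * I * n / Real.log p) + 1) ^ ℓ / (2 * (2 * π * I * n / Real.log p) - 3) ^ (ℓ + 2))) := by
  have hlogR : 0 < Real.log p := Real.log_pos (by exact_mod_cast hp)
  have hm0 : (0 : ℝ) < m := Nat.cast_pos.mpr hm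
  obtain ⟨K, hK, hKb⟩ := exists_norm_rhoFactor_le_of_le_abs_im hm k (0 : ℝ)
  have hs := (summable_residues_rhoPrime_kernel hp ℓ).norm.mul_left (K / 8)
  refine Summable.of_norm_bounded_eventually hs ?_
  -- for `|n| ≥ N₀` (`2π|n|/log p ≥ 2m`) the Stirling bound applies
  obtain ⟨N₀, hN₀⟩ := exists_nat_ge (m * Real.log p / π)
  rw [Filter.eventually_cofinite]
  refine (Set.finite_Icc (-(N₀ : ℤ)) N₀).subset fun n hn => ?_
  rw [mem_Icc]
  by_contra hout
  apply hn
  have hn2 : (N₀ : ℝ) < |(n : ℝ)| := by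
    rw [← Int.cast_abs]
    have : (N₀ : ℤ) < |n| := by
      rcases not_and_or.1 hout with h | h
      · have := not_le.1 h; rw [abs_of_neg (by omega)]; omega
      · have := not_le.1 h; rw [abs_of_pos (by omega)]; omega
    exact_mod_cast this
  have hn0 : n ≠ 0 := by
    rintro rfl
    simp at hn2
    linarith [N₀.cast_nonneg (α := ℝ)]
  rw [if_neg hn0]
  set zn : ℂ := 2 * π * I * n / Real.log p with hzn
  have hzn' : zn = ((0 : ℝ) : ℂ) + (2 * π * n / Real.log p : ℝ) * I := by
    rw [hzn]; push_cast; ring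
  have him : 2 * (m : ℝ) ≤ |(2 * π * n / Real.log p : ℝ)| := by
    rw [abs_div, abs_of_pos hlogR, le_div_iff₀ hlogR, abs_mul, abs_of_pos (by positivity : (0:ℝ) < 2 * π)]
    have : m * Real.log p / π * π = m * Real.log p := div_mul_cancel₀ _ Real.pi_ne_zero
    nlinarith [Real.pi_pos, hN₀]
  have hrho : ‖rhoFactor m k zn‖ ≤ K := by
    rw [hzn']
    exact hKb 0 (by norm_num) _ him
  have hK' : rhoFactor m k zn * ((1 - (p : ℂ)⁻¹) / Real.log p *
      ((2 * zn + 1) ^ ℓ / (2 * zn - 3) ^ (ℓ + 2))) = rhoFactor m k zn * (-(1 / 8 : ℂ)) *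
      (8 * (1 - (p : ℂ)⁻¹) * Real.log p / (4 * π * n + 3 * I * Real.log p) ^ 2 * xPrime p n ^ ℓ) := by
    rw [← residueCoeff_eq hp n ℓ, ← hzn, fp_kernel_eq]
    ring
  rw [hK', norm_mul, norm_mul]
  have : ‖(-(1 / 8 : ℂ))‖ = 1 / 8 := by simp
  rw [this]
  calc ‖rhoFactor m k zn‖ * (1 / 8) * ‖8 * (1 - (p : ℂ)⁻¹) * Real.log p / (4 * π * n + 3 * I * Real.log p) ^ 2 *
        xPrime p n ^ ℓ‖ ≤ K * (1 / 8) * ‖8 * (1 - (p : ℂ)⁻¹) * Real.log p /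
          (4 * π * n + 3 * I * Real.log p) ^ 2 * xPrime p n ^ ℓ‖ := by gcongr
    _ = K / 8 * ‖8 * (1 - (p : ℂ)⁻¹) * Real.log p / (4 * π * n + 3 * I * Real.log p) ^ 2 *
          xPrime p n ^ ℓ‖ := by ring

/-- RH-FREE. **The strip identity for `ρ_∞^{(m,k)}ρ_p`** (the rectangles of `rectBoundaryIntegral_factorPrime`,
`M → ∞`: the horizontal sides `Im z = ±(2M+1)π/log p` tend to `0` since `|ρ_∞^{(m,k)}| ≤ K` there
(Stirling), `|ρ_p| ≤ 1`, `|K_ℓ| ≤ 1/4R²`, while the vertical sides converge absolutely):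
`∫_ℝ F_ℓ(½+iy)dy − ∫_ℝ F_ℓ(½−2mj+iy)dy = 2π[Σ_{n<j, p_n≠0} Res_{p_n} + Σ_{n≠0} Res_{2πin/log p} + b]`.
[cite: ConnesConsani2021QuasiInner, Thm 4.8 proof (arXiv chunk p0014:L64) with Thm 4.4 proof (p0011:L104–p0012:L9)] -/
theorem integral_factorPrime_line_sub_eq {m : ℕ} (hm : 0 < m) {k : ℕ} (hk : k < m) {p : ℕ} (hp : p.Prime)
    (ℓ : ℕ) {a b : ℂ}
    (hab : ∃ ψ : ℂ → ℂ, ∃ W ∈ 𝓝 (0 : ℂ), DifferentiableOn ℂ ψ W ∧ ψ 0 = 0 ∧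
      ∀ z ∈ W, z ≠ 0 →
        rhoFactor m k z * rhoPrime p z * ((2 * z + 1) ^ ℓ / (2 * z - 3) ^ (ℓ + 2)) - a / z ^ 2 - b / z =
          ψ z / (z - 0))
    {j : ℕ} (hj : 1 ≤ j) :
    (∫ y : ℝ, rhoFactor m k ((((1 / 2 : ℝ)) : ℂ) + y * I) * rhoPrime p ((((1 / 2 : ℝ)) : ℂ) + y * I) *
        ((2 * ((((1 / 2 : ℝ)) : ℂ) + y * I) + 1) ^ ℓ / (2 * ((((1 / 2 : ℝ)) : ℂ) + y * I) - 3) ^ (ℓ + 2))) -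
      ∫ y : ℝ, rhoFactor m k ((((1 / 2 - 2 * m * j : ℝ)) : ℂ) + y * I) *
        rhoPrime p ((((1 / 2 - 2 * m * j : ℝ)) : ℂ) + y * I) *
        ((2 * ((((1 / 2 - 2 * m * j : ℝ)) : ℂ) + y * I) + 1) ^ ℓ /
          (2 * ((((1 / 2 - 2 * m * j : ℝ)) : ℂ) + y * I) - 3) ^ (ℓ + 2)) =
      2 * π *
        ((∑ n ∈ (Finset.range j).filter (fun n => ¬(k = 0 ∧ n = 0)),
            (2 * (m : ℂ) * ((π : ℂ) / m) ^ (1 / (2 * (m : ℂ)) - (-(2 * (k : ℂ) + 2 * (m : ℂ) * (n : ℂ))) / m) *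
          (Complex.Gamma ((1 - (-(2 * (k : ℂ) + 2 * (m : ℂ) * (n : ℂ)))) / (2 * (m : ℂ)) + (k : ℂ) / (m : ℂ)))⁻¹ /
            ((-1) ^ n * (n ! : ℂ))) *
              (rhoPrime p (-(2 * (k : ℂ) + 2 * (m : ℂ) * (n : ℂ))) *
                ((2 * (-(2 * (k : ℂ) + 2 * (m : ℂ) * (n : ℂ))) + 1) ^ ℓ /
                  (2 * (-(2 * (k : ℂ) + 2 * (m : ℂ) * (n : ℂ))) - 3) ^ (ℓ + 2)))) +
          (∑' n : ℤ, if n = 0 then (0 : ℂ) else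
            rhoFactor m k (2 * π * I * n / Real.log p) * ((1 - (p : ℂ)⁻¹) / Real.log p *
              ((2 * (2 * π * I * n / Real.log p) + 1) ^ ℓ /
                (2 * (2 * π * I * n / Real.log p) - 3) ^ (ℓ + 2)))) + b) := by
  have hp1 : 1 < p := hp.one_lt
  have hp1R : (1 : ℝ) < p := by exact_mod_cast hp1
  have hlogR : 0 < Real.log p := Real.log_pos hp1R
  have hj1 : (1 : ℝ) ≤ j := by exact_mod_cast hj
  have hm1 : (1 : ℝ) ≤ m := by exact_mod_cast hm
  have hm0 : (0 : ℝ) < m := by positivity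
  have hmj : (1 : ℝ) ≤ (m : ℝ) * j := by nlinarith
  set aj : ℝ := 1 / 2 - 2 * m * j with haj
  have haj0 : aj < 0 := by rw [haj]; linarith
  set F : ℂ → ℂ := fun z => rhoFactor m k z * rhoPrime p z * ((2 * z + 1) ^ ℓ / (2 * z - 3) ^ (ℓ + 2))
    with hF
  -- the residue series
  set T : ℤ → ℂ := fun n => if n = 0 then (0 : ℂ) else
      rhoFactor m k (2 * π * I * n / Real.log p) * ((1 - (p : ℂ)⁻¹) / Real.log p *
        ((2 * (2 * π * I * n / Real.log p) + 1) ^ ℓ / (2 * (2 * π * I * n / Real.log p) - 3) ^ (ℓ + 2)))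
    with hT
  have hsum : Summable T := summable_factorPrime_primeResidues hm k hp1 ℓ
  set A : ℂ := ∑ n ∈ (Finset.range j).filter (fun n => ¬(k = 0 ∧ n = 0)),
      (2 * (m : ℂ) * ((π : ℂ) / m) ^ (1 / (2 * (m : ℂ)) - (-(2 * (k : ℂ) + 2 * (m : ℂ) * (n : ℂ))) / m) *
          (Complex.Gamma ((1 - (-(2 * (k : ℂ) + 2 * (m : ℂ) * (n : ℂ)))) / (2 * (m : ℂ)) + (k : ℂ) / (m : ℂ)))⁻¹ /
            ((-1) ^ n * (n ! : ℂ))) *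
        (rhoPrime p (-(2 * (k : ℂ) + 2 * (m : ℂ) * (n : ℂ))) *
          ((2 * (-(2 * (k : ℂ) + 2 * (m : ℂ) * (n : ℂ))) + 1) ^ ℓ /
            (2 * (-(2 * (k : ℂ) + 2 * (m : ℂ) * (n : ℂ))) - 3) ^ (ℓ + 2))) with hA
  -- (i) the partial sums over `0 < |n| ≤ M` converge to the sum of the series
  have h_partial : Tendsto (fun M : ℕ => ∑ n ∈ (Finset.Icc (-(M : ℤ)) M).erase 0,
      rhoFactor m k (2 * π * I * n / Real.log p) * ((1 - (p : ℂ)⁻¹) / Real.log p *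
        ((2 * (2 * π * I * n / Real.log p) + 1) ^ ℓ / (2 * (2 * π * I * n / Real.log p) - 3) ^ (ℓ + 2))))
      atTop (𝓝 (∑' n : ℤ, T n)) := by
    have h := hsum.hasSum.comp Finset.tendsto_Icc_neg
    refine h.congr fun M => ?_
    simp only [Function.comp]
    rw [← Finset.sum_erase (Finset.Icc (-(M : ℤ)) M) (f := T) (a := 0) (by rw [hT]; simp)]
    refine Finset.sum_congr rfl fun n hn => ?_
    rw [hT]
    dsimp only
    rw [if_neg (Finset.mem_erase.1 hn).1]
  -- (ii) the height `R_M → ∞`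
  have hR : Tendsto (fun M : ℕ => (2 * (M : ℝ) + 1) * π / Real.log p) atTop atTop :=
    ((tendsto_atTop_add_const_right _ _ (tendsto_natCast_atTop_atTop.const_mul_atTop
      (by norm_num : (0 : ℝ) < 2))).atTop_mul_const Real.pi_pos).atTop_div_const hlogR
  -- bounds for `ρ_∞^{(m,k)}`, `ρ_p`
  obtain ⟨K, hK, hKb⟩ := exists_norm_rhoFactor_le_of_le_abs_im hm k aj
  have hcp : 0 ≤ (1 + (p : ℝ)⁻¹) / ((p : ℝ) ^ (3 / 2 : ℝ) - 1) := by
    have : 1 < (p : ℝ) ^ (3 / 2 : ℝ) := Real.one_lt_rpow hp1R (by norm_num)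
    exact div_nonneg (by positivity) (by linarith)
  -- no pole on the vertical lines
  have hc_half : ∀ n : ℕ, (1 / 2 : ℝ) ≠ -(2 * k + 2 * m * n) := by
    intro n h
    have : (0 : ℝ) ≤ 2 * k + 2 * m * n := by positivity
    linarith
  have hc_aj : ∀ n : ℕ, aj ≠ -(2 * k + 2 * m * n) := by
    intro n h
    rw [haj] at h
    have h2 : (1 : ℝ) = 4 * ((m : ℝ) * j - k - m * n) := by linarith
    have h3 : (1 : ℤ) = 4 * ((m : ℤ) * j - k - m * n) := by exact_mod_cast h2
    omega
  -- (iii) the right side converges to the line integral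
  have hint_right : Integrable fun y : ℝ => F ((((1 / 2 : ℝ)) : ℂ) + y * I) := by
    refine fp_integrable_F_vertical hm k hp1 ℓ (B := 1) hc_half (by norm_num) le_rfl fun y => ?_
    rw [show ((((1 / 2 : ℝ)) : ℂ)) + (y : ℂ) * I = 1 / 2 + y * I by push_cast; ring,
      lemma_4_7_norm hm k y, norm_rhoPrime_critical_line hp1, mul_one]
  have h_right : Tendsto (fun M : ℕ =>
      ∫ y in (-((2 * M + 1) * π / Real.log p))..((2 * M + 1) * π / Real.log p),
        F ((((1 / 2 : ℝ)) : ℂ) + y * I)) atTop (𝓝 (∫ y : ℝ, F ((((1 / 2 : ℝ)) : ℂ) + y * I))) :=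
    intervalIntegral_tendsto_integral hint_right (tendsto_neg_atTop_atBot.comp hR) hR
  -- (iv) the left side converges to the line integral
  have hBleft : ∀ y : ℝ, ‖rhoFactor m k ((aj : ℂ) + y * I)‖ * ‖rhoPrime p ((aj : ℂ) + y * I)‖ ≤
      (16 * π ^ 2 / 3) ^ min j 4 * ((1 + (p : ℝ)⁻¹) / ((p : ℝ) ^ (3 / 2 : ℝ) - 1)) := by
    intro y
    refine mul_le_mul (norm_rhoFactor_leftLine_le hm hk j y) (norm_rhoPrime_le_of_re_le hp1 (by norm_num)
      (by simp; rw [haj]; linarith)) (norm_nonneg _) (by positivity)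
  have hint_left : Integrable fun y : ℝ => F ((aj : ℂ) + y * I) :=
    fp_integrable_F_vertical hm k hp1 ℓ hc_aj haj0.ne (by linarith) hBleft
  have h_left : Tendsto (fun M : ℕ =>
      ∫ y in (-((2 * M + 1) * π / Real.log p))..((2 * M + 1) * π / Real.log p),
        F ((aj : ℂ) + y * I)) atTop (𝓝 (∫ y : ℝ, F ((aj : ℂ) + y * I))) :=
    intervalIntegral_tendsto_integral hint_left (tendsto_neg_atTop_atBot.comp hR) hR
  -- (v) the horizontal sides tend to `0`
  have h_small : Tendsto (fun M : ℕ => K * (2 * m * j) / (4 * ((2 * (M : ℝ) + 1) * π / Real.log p) ^ 2))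
      atTop (𝓝 0) := by
    have h2 : Tendsto (fun M : ℕ => 4 * ((2 * (M : ℝ) + 1) * π / Real.log p) ^ 2) atTop atTop :=
      Tendsto.const_mul_atTop (by norm_num) (Tendsto.atTop_mul_atTop₀ hR hR |>.congr fun M => by ring)
    exact tendsto_const_nhds.div_atTop h2
  have hhor : ∀ M : ℕ, 2 * (m : ℝ) ≤ (2 * (M : ℝ) + 1) * π / Real.log p → ∀ (s : ℝ),
      |s| = (2 * (M : ℝ) + 1) * π / Real.log p → (∃ q : ℤ, s = (2 * q + 1) * π / Real.log p) →
      ‖∫ x in aj..(1 / 2 : ℝ), F ((x : ℂ) + (s : ℂ) * I)‖ ≤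
        K * (2 * m * j) / (4 * ((2 * (M : ℝ) + 1) * π / Real.log p) ^ 2) := by
    intro M hM2 s hs hq
    obtain ⟨q, hq⟩ := hq
    set Rm : ℝ := (2 * (M : ℝ) + 1) * π / Real.log p with hRm
    have hRm0 : 0 < Rm := by positivity
    have hbound : ∀ x ∈ Ι aj (1 / 2 : ℝ), ‖F ((x : ℂ) + (s : ℂ) * I)‖ ≤ K / (4 * Rm ^ 2) := by
      intro x hx
      rw [Set.uIoc_of_le (by linarith)] at hx
      have hxre : ((x : ℂ) + (s : ℂ) * I).re ≤ 1 / 2 := by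
        have : ((x : ℂ) + (s : ℂ) * I).re = x := by simp
        rw [this]; exact hx.2
      have h1 : ‖rhoFactor m k ((x : ℂ) + (s : ℂ) * I)‖ ≤ K := hKb x ⟨hx.1.le, hx.2⟩ s (by rw [hs]; exact hM2)
      have h2 : ‖rhoPrime p ((x : ℂ) + (s : ℂ) * I)‖ ≤ 1 := by
        rw [hq]
        exact norm_rhoPrime_le_one_of_re_le_half hp1 q hx.2
      have h3 : (‖2 * ((x : ℂ) + (s : ℂ) * I) - 3‖ ^ 2)⁻¹ ≤ (4 * Rm ^ 2)⁻¹ := by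
        refine inv_anti₀ (by positivity) ?_
        have h4 := fp_four_mul_le_normSq hxre
        simp only [add_im, ofReal_im, mul_im, ofReal_re, I_im, mul_one, I_re, mul_zero, add_zero,
          zero_add] at h4
        have : s ^ 2 = Rm ^ 2 := by rw [← sq_abs, hs]
        nlinarith
      calc ‖F ((x : ℂ) + (s : ℂ) * I)‖ ≤ ‖rhoFactor m k ((x : ℂ) + (s : ℂ) * I)‖ *
            ‖rhoPrime p ((x : ℂ) + (s : ℂ) * I)‖ * (‖2 * ((x : ℂ) + (s : ℂ) * I) - 3‖ ^ 2)⁻¹ :=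
            fp_norm_F_le ℓ hxre
        _ ≤ K * 1 * (4 * Rm ^ 2)⁻¹ :=
            mul_le_mul (mul_le_mul h1 h2 (norm_nonneg _) hK.le) h3 (by positivity) (by positivity)
        _ = K / (4 * Rm ^ 2) := by ring
    refine (intervalIntegral.norm_integral_le_of_norm_le_const hbound).trans (le_of_eq ?_)
    rw [haj, show |1 / 2 - (1 / 2 - 2 * (m : ℝ) * j)| = 2 * m * j by
      rw [abs_of_nonneg (by nlinarith)]; ring]
    field_simp
  obtain ⟨M₀, hM₀⟩ : ∃ M₀ : ℕ, ∀ M : ℕ, M₀ ≤ M → 2 * (m : ℝ) ≤ (2 * (M : ℝ) + 1) * π / Real.log p := by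
    have := (hR.eventually (eventually_ge_atTop (2 * (m : ℝ))))
    rw [eventually_atTop] at this
    exact this
  have h_top : Tendsto (fun M : ℕ => ∫ x in aj..(1 / 2 : ℝ),
      F ((x : ℂ) + (((2 * M + 1) * π / Real.log p : ℝ) : ℂ) * I)) atTop (𝓝 0) := by
    refine squeeze_zero_norm' ?_ h_small
    filter_upwards [eventually_ge_atTop M₀] with M hMM
    exact hhor M (hM₀ M hMM) _ (abs_of_pos (by positivity)) ⟨M, by push_cast; ring⟩
  have h_bot : Tendsto (fun M : ℕ => ∫ x in aj..(1 / 2 : ℝ),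
      F ((x : ℂ) + ((-((2 * M + 1) * π / Real.log p) : ℝ) : ℂ) * I)) atTop (𝓝 0) := by
    refine squeeze_zero_norm' ?_ h_small
    filter_upwards [eventually_ge_atTop M₀] with M hMM
    refine hhor M (hM₀ M hMM) _ (by rw [abs_neg, abs_of_pos (by positivity)]) ⟨-(M : ℤ) - 1, ?_⟩
    push_cast; ring
  -- (vi) the boundary integrals converge …
  have h_box : Tendsto (fun M : ℕ => Literature.Analysis.Complex.rectBoundaryIntegral F aj (1 / 2)
        (-((2 * M + 1) * π / Real.log p)) ((2 * M + 1) * π / Real.log p))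
      atTop (𝓝 (0 - 0 + I * (∫ y : ℝ, F ((((1 / 2 : ℝ)) : ℂ) + y * I)) -
        I * (∫ y : ℝ, F ((aj : ℂ) + y * I)))) := by
    have h := ((h_bot.sub h_top).add (h_right.const_mul I)).sub (h_left.const_mul I)
    refine h.congr fun M => ?_
    rw [Literature.Analysis.Complex.rectBoundaryIntegral_def]
  -- (vii) … and by the residue formula they are `2πi` times the partial sums
  have h_val : Tendsto (fun M : ℕ => Literature.Analysis.Complex.rectBoundaryIntegral F aj (1 / 2)
        (-((2 * M + 1) * π / Real.log p)) ((2 * M + 1) * π / Real.log p))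
      atTop (𝓝 (2 * π * I * (A + (∑' n : ℤ, T n) + b))) := by
    have h := ((tendsto_const_nhds (x := A)).add h_partial).add (tendsto_const_nhds (x := b))
    have h' := h.const_mul (2 * π * I)
    refine h'.congr' ?_
    filter_upwards [eventually_ge_atTop 1] with M hMM
    rw [hF, haj]
    exact (rectBoundaryIntegral_factorPrime hm hk hp ℓ hab hj hMM).symm
  have h_eq := tendsto_nhds_unique h_box h_val
  rw [sub_zero, zero_add] at h_eq
  have hI : (I : ℂ) ≠ 0 := I_ne_zero
  have key : (∫ y : ℝ, F ((((1 / 2 : ℝ)) : ℂ) + y * I)) - (∫ y : ℝ, F ((aj : ℂ) + y * I)) =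
      2 * π * (A + (∑' n : ℤ, T n) + b) := by
    have h3 := h_eq
    rw [← mul_sub, show 2 * (π : ℂ) * I * (A + (∑' n : ℤ, T n) + b) =
      I * (2 * π * (A + (∑' n : ℤ, T n) + b)) by ring] at h3
    exact mul_left_cancel₀ hI h3
  rw [haj] at key
  simpa only [hF, hA, hT] using key

end StripLimit

/-! ### F. Letting `j → ∞`: the line integral over `∂ℂ₋` as the full series of residues -/

section LineLimit

/-- RH-FREE. **The residues at the poles of `ρ_∞^{(m,k)}` are absolutely summable** («the residues at these
poles decay extremely fast to `0` as in the case of `ρ_∞`», Lemma 4.7: `|r_n| ≤ 2m(π/m)^{(1+4k)/(2m)}(π/m)^{2n}/n!`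
for `n ≥ 2`; `|ρ_p(p_n)| ≤ (1+p⁻¹)/(p²−1)`, `|K_ℓ| ≤ 1`).
[cite: ConnesConsani2021QuasiInner, Lemma 4.7 proof (arXiv chunk p0014:L56), Thm 4.8 proof (p0014:L64)] -/
theorem summable_factorPrime_archResidues {m : ℕ} (hm : 0 < m) (k : ℕ) {p : ℕ} (hp : 1 < p) (ℓ : ℕ) :
    Summable fun n : ℕ => if k = 0 ∧ n = 0 then (0 : ℂ) else
      (2 * (m : ℂ) * ((π : ℂ) / m) ^ (1 / (2 * (m : ℂ)) - (-(2 * (k : ℂ) + 2 * (m : ℂ) * (n : ℂ))) / m) *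
          (Complex.Gamma ((1 - (-(2 * (k : ℂ) + 2 * (m : ℂ) * (n : ℂ)))) / (2 * (m : ℂ)) + (k : ℂ) / (m : ℂ)))⁻¹ /
            ((-1) ^ n * (n ! : ℂ))) *
        (rhoPrime p (-(2 * (k : ℂ) + 2 * (m : ℂ) * (n : ℂ))) *
          ((2 * (-(2 * (k : ℂ) + 2 * (m : ℂ) * (n : ℂ))) + 1) ^ ℓ /
            (2 * (-(2 * (k : ℂ) + 2 * (m : ℂ) * (n : ℂ))) - 3) ^ (ℓ + 2))) := by
  have hp1R : (1 : ℝ) < p := by exact_mod_cast hp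
  have hm0 : (0 : ℝ) < m := Nat.cast_pos.mpr hm
  set c : ℝ := (1 + (p : ℝ)⁻¹) / ((p : ℝ) ^ (2 : ℝ) - 1) with hc
  have hc0 : 0 ≤ c := by
    have : 1 < (p : ℝ) ^ (2 : ℝ) := Real.one_lt_rpow hp1R (by norm_num)
    exact div_nonneg (by positivity) (by linarith)
  set C₀ : ℝ := 2 * m * (π / m) ^ ((1 + 4 * k) / (2 * m) : ℝ) with hC₀
  have hmaj : Summable fun n : ℕ => C₀ * ((π / m) ^ 2) ^ n / n ! * c := by
    have h := ((Real.summable_pow_div_factorial ((π / m) ^ 2)).mul_left C₀).mul_right c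
    refine h.congr fun n => ?_
    ring
  refine Summable.of_norm_bounded_eventually hmaj ?_
  rw [Nat.cofinite_eq_atTop]
  filter_upwards [eventually_ge_atTop 2] with n hn
  have hkn : ¬(k = 0 ∧ n = 0) := fun h => by omega
  rw [if_neg hkn]
  have hres := norm_rhoFactor_residue_le hm k hn
  set q : ℂ := -(2 * (k : ℂ) + 2 * (m : ℂ) * (n : ℂ)) with hq
  have hqre : q.re = -(2 * k + 2 * m * n) := by rw [hq]; simp
  have hre : q.re ≤ 1 / 2 := by
    rw [hqre]
    have : (0 : ℝ) ≤ 2 * k + 2 * m * n := by positivity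
    linarith
  have hK : ‖(2 * q + 1) ^ ℓ / (2 * q - 3) ^ (ℓ + 2)‖ ≤ 1 := by
    refine (norm_ratFactor_le hre ℓ).trans ?_
    have h4 := fp_four_mul_le_normSq hre
    have : (4 : ℝ) ≤ ‖2 * q - 3‖ ^ 2 := le_trans (by nlinarith [sq_nonneg q.im]) h4
    exact inv_le_one_of_one_le₀ (by linarith)
  have hρ : ‖rhoPrime p q‖ ≤ c := by
    refine norm_rhoPrime_le_of_re_le hp (by norm_num) ?_
    rw [hqre]
    have h2 : (2 : ℝ) ≤ n := by exact_mod_cast hn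
    have : (1 : ℝ) ≤ m := by exact_mod_cast hm
    have hk0 : (0 : ℝ) ≤ k := k.cast_nonneg
    nlinarith
  rw [norm_mul, norm_mul]
  calc ‖(2 * (m : ℂ) * ((π : ℂ) / m) ^ (1 / (2 * (m : ℂ)) - (-(2 * (k : ℂ) + 2 * (m : ℂ) * (n : ℂ))) / m) *
          (Complex.Gamma ((1 - (-(2 * (k : ℂ) + 2 * (m : ℂ) * (n : ℂ)))) / (2 * (m : ℂ)) + (k : ℂ) / (m : ℂ)))⁻¹ /
            ((-1) ^ n * (n ! : ℂ)))‖ * (‖rhoPrime p q‖ * ‖(2 * q + 1) ^ ℓ / (2 * q - 3) ^ (ℓ + 2)‖)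
      ≤ (C₀ * ((π / m) ^ 2) ^ n / n !) * (c * 1) :=
        mul_le_mul hres (mul_le_mul hρ hK (norm_nonneg _) hc0) (by positivity) (by positivity)
    _ = C₀ * ((π / m) ^ 2) ^ n / n ! * c := by rw [mul_one]

set_option maxHeartbeats 800000 in
/-- RH-FREE. **`∫_{∂ℂ₋} ρ_∞^{(m,k)}ρ_p(z)(2z+1)^ℓ(2z−3)^{−ℓ−2}` as the full series of residues** (the contour
of Section 2: `M → ∞`, then `j → ∞` along the lines `Re z = ½ − 2mj` of Lemma 4.6/4.7 where
`|ρ_∞^{(m,k)}| ≤ (16π²/3)^4`): `∫_ℝ F_ℓ(½+iy)dy = 2π[Σ_{n, p_n≠0} Res_{p_n} + Σ_{n≠0} Res_{2πin/log p} + b]`,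
where `az⁻² + bz⁻¹` is the principal part at `0`.
[cite: ConnesConsani2021QuasiInner, Thm 4.8 proof (arXiv chunk p0014:L64) with Thm 4.4 proof (p0011:L104–p0012:L29)] -/
theorem integral_factorPrime_criticalLine_eq_tsum {m : ℕ} (hm : 0 < m) {k : ℕ} (hk : k < m) {p : ℕ}
    (hp : p.Prime) (ℓ : ℕ) {a b : ℂ}
    (hab : ∃ ψ : ℂ → ℂ, ∃ W ∈ 𝓝 (0 : ℂ), DifferentiableOn ℂ ψ W ∧ ψ 0 = 0 ∧
      ∀ z ∈ W, z ≠ 0 →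
        rhoFactor m k z * rhoPrime p z * ((2 * z + 1) ^ ℓ / (2 * z - 3) ^ (ℓ + 2)) - a / z ^ 2 - b / z =
          ψ z / (z - 0)) :
    ∫ y : ℝ, rhoFactor m k ((((1 / 2 : ℝ)) : ℂ) + y * I) * rhoPrime p ((((1 / 2 : ℝ)) : ℂ) + y * I) *
        ((2 * ((((1 / 2 : ℝ)) : ℂ) + y * I) + 1) ^ ℓ / (2 * ((((1 / 2 : ℝ)) : ℂ) + y * I) - 3) ^ (ℓ + 2)) =
      2 * π *
        ((∑' n : ℕ, if k = 0 ∧ n = 0 then (0 : ℂ) else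
            (2 * (m : ℂ) * ((π : ℂ) / m) ^ (1 / (2 * (m : ℂ)) - (-(2 * (k : ℂ) + 2 * (m : ℂ) * (n : ℂ))) / m) *
          (Complex.Gamma ((1 - (-(2 * (k : ℂ) + 2 * (m : ℂ) * (n : ℂ)))) / (2 * (m : ℂ)) + (k : ℂ) / (m : ℂ)))⁻¹ /
            ((-1) ^ n * (n ! : ℂ))) *
              (rhoPrime p (-(2 * (k : ℂ) + 2 * (m : ℂ) * (n : ℂ))) *
                ((2 * (-(2 * (k : ℂ) + 2 * (m : ℂ) * (n : ℂ))) + 1) ^ ℓ /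
                  (2 * (-(2 * (k : ℂ) + 2 * (m : ℂ) * (n : ℂ))) - 3) ^ (ℓ + 2)))) +
          (∑' n : ℤ, if n = 0 then (0 : ℂ) else
            rhoFactor m k (2 * π * I * n / Real.log p) * ((1 - (p : ℂ)⁻¹) / Real.log p *
              ((2 * (2 * π * I * n / Real.log p) + 1) ^ ℓ /
                (2 * (2 * π * I * n / Real.log p) - 3) ^ (ℓ + 2)))) + b) := by
  classical
  have hp1 : 1 < p := hp.one_lt
  have hp1R : (1 : ℝ) < p := by exact_mod_cast hp1
  have hm0 : (0 : ℝ) < m := Nat.cast_pos.mpr hm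
  have hm1 : (1 : ℝ) ≤ m := by exact_mod_cast hm
  set F : ℂ → ℂ := fun z => rhoFactor m k z * rhoPrime p z * ((2 * z + 1) ^ ℓ / (2 * z - 3) ^ (ℓ + 2))
    with hF
  set res : ℕ → ℂ := fun n =>
      (2 * (m : ℂ) * ((π : ℂ) / m) ^ (1 / (2 * (m : ℂ)) - (-(2 * (k : ℂ) + 2 * (m : ℂ) * (n : ℂ))) / m) *
          (Complex.Gamma ((1 - (-(2 * (k : ℂ) + 2 * (m : ℂ) * (n : ℂ)))) / (2 * (m : ℂ)) + (k : ℂ) / (m : ℂ)))⁻¹ /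
            ((-1) ^ n * (n ! : ℂ))) *
        (rhoPrime p (-(2 * (k : ℂ) + 2 * (m : ℂ) * (n : ℂ))) *
          ((2 * (-(2 * (k : ℂ) + 2 * (m : ℂ) * (n : ℂ))) + 1) ^ ℓ /
            (2 * (-(2 * (k : ℂ) + 2 * (m : ℂ) * (n : ℂ))) - 3) ^ (ℓ + 2))) with hres
  set res' : ℕ → ℂ := fun n => if k = 0 ∧ n = 0 then (0 : ℂ) else res n with hres'
  set ST : ℂ := ∑' n : ℤ, if n = 0 then (0 : ℂ) else
      rhoFactor m k (2 * π * I * n / Real.log p) * ((1 - (p : ℂ)⁻¹) / Real.log p *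
        ((2 * (2 * π * I * n / Real.log p) + 1) ^ ℓ / (2 * (2 * π * I * n / Real.log p) - 3) ^ (ℓ + 2)))
    with hST
  set Ib : ℂ := ∫ y : ℝ, F ((((1 / 2 : ℝ)) : ℂ) + y * I) with hIb
  set Lj : ℕ → ℂ := fun j => ∫ y : ℝ, F ((((1 / 2 - 2 * m * j : ℝ)) : ℂ) + y * I) with hLj
  have hsumres : Summable res' := by
    have h := summable_factorPrime_archResidues hm k hp1 ℓ
    refine h.congr fun n => ?_
    rw [hres', hres]
  -- the identity at level `j`
  have hconst : ∀ᶠ j : ℕ in atTop, Lj j + 2 * π * ∑ n ∈ Finset.range j, res' n = Ib - 2 * π * (ST + b) := by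
    filter_upwards [eventually_ge_atTop 1] with j hj
    have h := integral_factorPrime_line_sub_eq hm hk hp ℓ hab hj
    have hfilt : ∑ n ∈ (Finset.range j).filter (fun n => ¬(k = 0 ∧ n = 0)), res n =
        ∑ n ∈ Finset.range j, res' n := by
      rw [Finset.sum_filter]
      refine Finset.sum_congr rfl fun n _ => ?_
      rw [hres']
      dsimp only
      split_ifs with h1 <;> simp_all
    have h' : Ib - Lj j = 2 * π * ((∑ n ∈ Finset.range j, res' n) + ST + b) := by
      rw [← hfilt, hIb, hLj, hres, hST]
      exact h
    linear_combination (-1 : ℂ) * h'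
  -- the left side tends to `0`
  have h_left : Tendsto Lj atTop (𝓝 0) := by
    set C : ℝ := (16 * π ^ 2 / 3) ^ 4 * ((1 + (p : ℝ)⁻¹) / ((p : ℝ) ^ (3 / 2 : ℝ) - 1)) with hC
    have hcp : 0 ≤ (1 + (p : ℝ)⁻¹) / ((p : ℝ) ^ (3 / 2 : ℝ) - 1) := by
      have : 1 < (p : ℝ) ^ (3 / 2 : ℝ) := Real.one_lt_rpow hp1R (by norm_num)
      exact div_nonneg (by positivity) (by linarith)
    have hC0 : 0 ≤ C := by positivity
    have hbase : (1 : ℝ) ≤ 16 * π ^ 2 / 3 := by nlinarith [Real.pi_gt_three]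
    have hbound : ∀ j : ℕ, 1 ≤ j → ‖Lj j‖ ≤ C * (π / (2 * (4 * m * j + 2))) := by
      intro j hj
      have hj1 : (1 : ℝ) ≤ j := by exact_mod_cast hj
      have hc : (0 : ℝ) < 4 * m * j + 2 := by positivity
      have hg : Integrable fun y : ℝ => C * ((4 * (m : ℝ) * j + 2) ^ 2 + 4 * y ^ 2)⁻¹ := by
        have hcont : Continuous fun y : ℝ => ((4 * (m : ℝ) * j + 2) ^ 2 + 4 * y ^ 2)⁻¹ :=
          Continuous.inv₀ (by fun_prop) fun y => by positivity
        refine (Integrable.mono' (integrable_inv_one_add_sq.const_mul (4⁻¹))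
          hcont.aestronglyMeasurable (Eventually.of_forall fun y => ?_)).const_mul C
        rw [Real.norm_eq_abs, abs_of_pos (by positivity)]
        have h2 : (2 : ℝ) ≤ 4 * (m : ℝ) * j + 2 := by nlinarith
        have : 4 * (1 + y ^ 2) ≤ (4 * (m : ℝ) * j + 2) ^ 2 + 4 * y ^ 2 := by nlinarith [h2]
        calc ((4 * (m : ℝ) * j + 2) ^ 2 + 4 * y ^ 2)⁻¹ ≤ (4 * (1 + y ^ 2))⁻¹ := inv_anti₀ (by positivity) this
          _ = 4⁻¹ * (1 + y ^ 2)⁻¹ := mul_inv _ _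
      rw [hLj]
      refine (norm_integral_le_of_norm_le hg (Eventually.of_forall fun y => ?_)).trans (le_of_eq ?_)
      · have hre : ((((1 / 2 - 2 * m * j : ℝ)) : ℂ) + y * I).re ≤ 1 / 2 := by
          simp; positivity
        have hsq : ‖2 * ((((1 / 2 - 2 * m * j : ℝ)) : ℂ) + y * I) - 3‖ ^ 2 =
            (4 * m * j + 2) ^ 2 + 4 * y ^ 2 := by
          rw [fp_normSq_two_mul_sub_three]
          simp
          ring
        have h1 : ‖rhoFactor m k ((((1 / 2 - 2 * m * j : ℝ)) : ℂ) + y * I)‖ ≤ (16 * π ^ 2 / 3) ^ 4 :=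
          (norm_rhoFactor_leftLine_le hm hk j y).trans (pow_le_pow_right₀ hbase (min_le_right j 4))
        have h2 : ‖rhoPrime p ((((1 / 2 - 2 * m * j : ℝ)) : ℂ) + y * I)‖ ≤
            (1 + (p : ℝ)⁻¹) / ((p : ℝ) ^ (3 / 2 : ℝ) - 1) :=
          norm_rhoPrime_le_of_re_le hp1 (by norm_num) (by
            simp
            have : (1 : ℝ) ≤ (m : ℝ) * j := by nlinarith
            linarith)
        calc ‖F ((((1 / 2 - 2 * m * j : ℝ)) : ℂ) + y * I)‖
            ≤ ‖rhoFactor m k ((((1 / 2 - 2 * m * j : ℝ)) : ℂ) + y * I)‖ *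
                ‖rhoPrime p ((((1 / 2 - 2 * m * j : ℝ)) : ℂ) + y * I)‖ *
                (‖2 * ((((1 / 2 - 2 * m * j : ℝ)) : ℂ) + y * I) - 3‖ ^ 2)⁻¹ := fp_norm_F_le ℓ hre
          _ ≤ C * ((4 * (m : ℝ) * j + 2) ^ 2 + 4 * y ^ 2)⁻¹ := by
              rw [hsq, hC]
              exact mul_le_mul_of_nonneg_right (mul_le_mul h1 h2 (norm_nonneg _) (by positivity))
                (by positivity)
      · rw [integral_const_mul]
        have h : (fun y : ℝ => ((4 * (m : ℝ) * j + 2) ^ 2 + 4 * y ^ 2)⁻¹) =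
            fun y : ℝ => ((4 * (m : ℝ) * j + 2) ^ 2)⁻¹ *
              (fun u : ℝ => (1 + u ^ 2)⁻¹) (2 / (4 * m * j + 2) * y) := by
          funext y
          simp only
          rw [← mul_inv]
          congr 1
          field_simp
          ring
        rw [h, integral_const_mul, Measure.integral_comp_mul_left (fun u : ℝ => (1 + u ^ 2)⁻¹),
          integral_univ_inv_one_add_sq, smul_eq_mul, inv_div, abs_of_pos (by positivity)]
        field_simp
    have hlim : Tendsto (fun j : ℕ => C * (π / (2 * (4 * (m : ℝ) * j + 2)))) atTop (𝓝 0) := by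
      have h1 : Tendsto (fun j : ℕ => 2 * (4 * (m : ℝ) * j + 2)) atTop atTop := by
        have h8 : Tendsto (fun j : ℕ => 8 * (m : ℝ) * (j : ℝ) + 4) atTop atTop :=
          tendsto_atTop_add_const_right _ 4
            (tendsto_natCast_atTop_atTop.const_mul_atTop (by positivity : (0:ℝ) < 8 * m))
        refine h8.congr fun j => ?_
        ring
      simpa using (tendsto_const_nhds.div_atTop h1).const_mul C
    refine squeeze_zero_norm' ?_ hlim
    filter_upwards [eventually_ge_atTop 1] with j hj
    exact hbound j hj
  -- the partial sums of the `ρ_∞^{(m,k)}`-residues converge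
  have h_res : Tendsto (fun j : ℕ => ∑ n ∈ Finset.range j, res' n) atTop (𝓝 (∑' n : ℕ, res' n)) :=
    hsumres.hasSum.tendsto_sum_nat
  have hlim : Tendsto (fun j : ℕ => Lj j + 2 * π * ∑ n ∈ Finset.range j, res' n) atTop
      (𝓝 (0 + 2 * π * ∑' n : ℕ, res' n)) := h_left.add (h_res.const_mul _)
  rw [zero_add] at hlim
  have hlim' : Tendsto (fun j : ℕ => Lj j + 2 * π * ∑ n ∈ Finset.range j, res' n) atTop
      (𝓝 (Ib - 2 * π * (ST + b))) := tendsto_const_nhds.congr' (EventuallyEq.symm hconst)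
  have h_eq := tendsto_nhds_unique hlim' hlim
  have : Ib = 2 * π * ((∑' n : ℕ, res' n) + ST + b) := by linear_combination h_eq
  rw [this, hres', hres]

end LineLimit

/-! ### G. The negative Fourier coefficients of `(ρ_∞^{(m,k)}ρ_p) ∘ ψ` on `S¹` -/

section FourierCoefficients

set_option maxHeartbeats 800000 in
/-- RH-FREE. **The negative Fourier coefficients of `(ρ_∞^{(m,k)}ρ_p) ∘ ψ` on `S¹`** («the results of §4.3
continue to hold with minor changes if one replaces `ρ_∞` by `ρ_∞^{(m,k)}`», the scalar content of the
decomposition `(1 − 𝒫)κ^{(m,k)}κ_p𝒫 = ℰ_∞ + ℰ_p + ℰ_0` for the factor): there are constants `A`, `B`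
(depending only on `m, k, p`) such that for every `ℓ ≥ 0`
`((ρ_∞^{(m,k)}ρ_p)∘ψ)^(−ℓ−1) = Σ_{n ≥ 0, p_n ≠ 0} c_n ψ⁻¹(p_n)^ℓ
 + Σ_{n≠0} ρ_∞^{(m,k)}(2πin/log p)·8(1−p⁻¹)log p(4πn+3i log p)⁻² x_p(n)^ℓ + (A + Bℓ)(−⅓)^ℓ`,
`p_n = −2k−2mn`, `c_n = −8 r_n ρ_p(p_n)(2p_n−3)⁻²` — the poles of `ρ_∞^{(m,k)}` with «the residue multiplied
by the value of the other factor», the poles of `ρ_p` with the residue (offdiag2) multiplied by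
`ρ_∞^{(m,k)}(2πin/log p)` (the entries of `D`), and the pole at `0` (the finite-rank `ℰ_0`).
[cite: ConnesConsani2021QuasiInner, Thm 4.8 proof (arXiv chunk p0014:L64) with Thm 4.4 (ii) proof (p0011:L102–p0012:L35)] -/
theorem exists_fourierCoeff_kappaFactorPrime_eq {m : ℕ} (hm : 0 < m) {k : ℕ} (hk : k < m) {p : ℕ}
    (hp : p.Prime) :
    ∃ A B : ℂ, ∀ ℓ : ℕ,
      fourierCoeff (T := 1) (circleRestrict 1 fun v => rhoFactor m k (cayley v) * kappaPrime p v)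
          (-((ℓ + 1 : ℕ) : ℤ)) =
        (∑' n : ℕ, if k = 0 ∧ n = 0 then (0 : ℂ) else
            (-8 * (2 * (m : ℂ) * ((π : ℂ) / m) ^ (1 / (2 * (m : ℂ)) - (-(2 * (k : ℂ) + 2 * (m : ℂ) * (n : ℂ))) / m) *
          (Complex.Gamma ((1 - (-(2 * (k : ℂ) + 2 * (m : ℂ) * (n : ℂ)))) / (2 * (m : ℂ)) + (k : ℂ) / (m : ℂ)))⁻¹ /
            ((-1) ^ n * (n ! : ℂ))) *
              rhoPrime p (-(2 * (k : ℂ) + 2 * (m : ℂ) * (n : ℂ))) /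
                (2 * (-(2 * (k : ℂ) + 2 * (m : ℂ) * (n : ℂ))) - 3) ^ 2) *
              cayleyInv (-(2 * (k : ℂ) + 2 * (m : ℂ) * (n : ℂ))) ^ ℓ) +
          (∑' n : ℤ, if n = 0 then (0 : ℂ) else
            rhoFactor m k (2 * π * I * n / Real.log p) *
              (8 * (1 - (p : ℂ)⁻¹) * Real.log p / (4 * π * n + 3 * I * Real.log p) ^ 2 * xPrime p n ^ ℓ)) +
          (A + B * ℓ) * (-1 / 3 : ℂ) ^ ℓ := by
  have hp1 : 1 < p := hp.one_lt
  have hπ : (π : ℂ) ≠ 0 := ofReal_ne_zero.mpr Real.pi_pos.ne'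
  obtain ⟨A₀, B₀, hAB⟩ := exists_factorPrime_doublePole_sub hm k hp1
  refine ⟨-8 * A₀, -8 * B₀, fun ℓ => ?_⟩
  obtain ⟨a, ψ, W, hW, hψd, hψ0, hψeq⟩ := hAB ℓ
  have hline := integral_factorPrime_criticalLine_eq_tsum hm hk hp ℓ (a := a)
    (b := (A₀ + B₀ * ℓ) * (-1 / 3 : ℂ) ^ ℓ) ⟨ψ, W, hW, hψd, hψ0, hψeq⟩
  -- the change of variables `S¹ → ∂ℂ₋`
  have hcov := fourierCoeff_circleRestrict_neg_eq_integral
    (fun v => rhoFactor m k (cayley v) * kappaPrime p v) (ℓ + 1)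
  have hpt : ∀ t : ℝ, (((π⁻¹ * (1 + t ^ 2)⁻¹ : ℝ)) : ℂ) *
      (cayleyInv (1 / 2 + t * I) ^ (ℓ + 1) *
        (fun v => rhoFactor m k (cayley v) * kappaPrime p v) (cayleyInv (1 / 2 + t * I))) =
      -(4 / π : ℂ) * (rhoFactor m k ((((1 / 2 : ℝ)) : ℂ) + t * I) * rhoPrime p ((((1 / 2 : ℝ)) : ℂ) + t * I) *
        ((2 * ((((1 / 2 : ℝ)) : ℂ) + t * I) + 1) ^ ℓ / (2 * ((((1 / 2 : ℝ)) : ℂ) + t * I) - 3) ^ (ℓ + 2))) := by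
    intro t
    set z : ℂ := 1 / 2 + (t : ℂ) * I with hzD
    have hz : z ≠ 3 / 2 := by
      intro h
      have := congrArg Complex.re h
      rw [hzD] at this
      simp at this
      norm_num at this
    have h12 : ((((1 / 2 : ℝ)) : ℂ)) + (t : ℂ) * I = z := by rw [hzD]; push_cast; ring
    simp only
    rw [h12, kappaPrime, cayley_cayleyInv hz, cayleyInv]
    set A : ℂ := 2 * z + 1 with hA
    set B : ℂ := 2 * z - 3 with hB
    have hA0 : A ≠ 0 := by
      intro h
      have := congrArg Complex.re h
      rw [hA, hzD] at this
      norm_num at this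
    have hB0 : B ≠ 0 := by
      intro h
      have := congrArg Complex.re h
      rw [hB, hzD] at this
      norm_num at this
    have hq : (((1 + t ^ 2 : ℝ)) : ℂ) = -(A * B) / 4 := by
      rw [hA, hB, hzD]
      push_cast
      linear_combination ((t : ℂ) ^ 2) * I_sq
    have hcast : (((π⁻¹ * (1 + t ^ 2)⁻¹ : ℝ)) : ℂ) = (π : ℂ)⁻¹ * ((((1 + t ^ 2 : ℝ)) : ℂ))⁻¹ := by
      push_cast; ring
    rw [hcast, hq, div_pow]
    field_simp
    ring
  rw [hcov]
  simp_rw [hpt]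
  rw [integral_const_mul, hline]
  -- the three groups of terms
  have hA : -(4 / π : ℂ) * (2 * π) = -8 := by field_simp; ring
  have e1 : ∀ n : ℕ,
      -8 * (if k = 0 ∧ n = 0 then (0 : ℂ) else
        (2 * (m : ℂ) * ((π : ℂ) / m) ^ (1 / (2 * (m : ℂ)) - (-(2 * (k : ℂ) + 2 * (m : ℂ) * (n : ℂ))) / m) *
          (Complex.Gamma ((1 - (-(2 * (k : ℂ) + 2 * (m : ℂ) * (n : ℂ)))) / (2 * (m : ℂ)) + (k : ℂ) / (m : ℂ)))⁻¹ /
            ((-1) ^ n * (n ! : ℂ))) *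
          (rhoPrime p (-(2 * (k : ℂ) + 2 * (m : ℂ) * (n : ℂ))) *
            ((2 * (-(2 * (k : ℂ) + 2 * (m : ℂ) * (n : ℂ))) + 1) ^ ℓ /
              (2 * (-(2 * (k : ℂ) + 2 * (m : ℂ) * (n : ℂ))) - 3) ^ (ℓ + 2)))) =
      (if k = 0 ∧ n = 0 then (0 : ℂ) else
        (-8 * (2 * (m : ℂ) * ((π : ℂ) / m) ^ (1 / (2 * (m : ℂ)) - (-(2 * (k : ℂ) + 2 * (m : ℂ) * (n : ℂ))) / m) *
          (Complex.Gamma ((1 - (-(2 * (k : ℂ) + 2 * (m : ℂ) * (n : ℂ)))) / (2 * (m : ℂ)) + (k : ℂ) / (m : ℂ)))⁻¹ /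
            ((-1) ^ n * (n ! : ℂ))) *
          rhoPrime p (-(2 * (k : ℂ) + 2 * (m : ℂ) * (n : ℂ))) /
            (2 * (-(2 * (k : ℂ) + 2 * (m : ℂ) * (n : ℂ))) - 3) ^ 2) *
          cayleyInv (-(2 * (k : ℂ) + 2 * (m : ℂ) * (n : ℂ))) ^ ℓ) := by
    intro n
    split_ifs with hkn
    · simp
    · have hre : (-(2 * (k : ℂ) + 2 * (m : ℂ) * (n : ℂ))).re < 3 / 2 := by
        simp
        have : (0 : ℝ) ≤ 2 * k + 2 * m * n := by positivity
        linarith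
      rw [fp_kernel_eq' hre]
      ring
  have e2 : ∀ n : ℤ, -8 * (if n = 0 then (0 : ℂ) else
      rhoFactor m k (2 * π * I * n / Real.log p) * ((1 - (p : ℂ)⁻¹) / Real.log p *
        ((2 * (2 * π * I * n / Real.log p) + 1) ^ ℓ / (2 * (2 * π * I * n / Real.log p) - 3) ^ (ℓ + 2)))) =
      (if n = 0 then (0 : ℂ) else rhoFactor m k (2 * π * I * n / Real.log p) *
        (8 * (1 - (p : ℂ)⁻¹) * Real.log p / (4 * π * n + 3 * I * Real.log p) ^ 2 * xPrime p n ^ ℓ)) := by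
    intro n
    split_ifs with hn
    · simp
    · rw [← residueCoeff_eq hp1 n ℓ, fp_kernel_eq]
      ring
  set S1 : ℂ := ∑' n : ℕ, if k = 0 ∧ n = 0 then (0 : ℂ) else
      (2 * (m : ℂ) * ((π : ℂ) / m) ^ (1 / (2 * (m : ℂ)) - (-(2 * (k : ℂ) + 2 * (m : ℂ) * (n : ℂ))) / m) *
          (Complex.Gamma ((1 - (-(2 * (k : ℂ) + 2 * (m : ℂ) * (n : ℂ)))) / (2 * (m : ℂ)) + (k : ℂ) / (m : ℂ)))⁻¹ /
            ((-1) ^ n * (n ! : ℂ))) *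
        (rhoPrime p (-(2 * (k : ℂ) + 2 * (m : ℂ) * (n : ℂ))) *
          ((2 * (-(2 * (k : ℂ) + 2 * (m : ℂ) * (n : ℂ))) + 1) ^ ℓ /
            (2 * (-(2 * (k : ℂ) + 2 * (m : ℂ) * (n : ℂ))) - 3) ^ (ℓ + 2))) with hS1
  set S2 : ℂ := ∑' n : ℤ, if n = 0 then (0 : ℂ) else
      rhoFactor m k (2 * π * I * n / Real.log p) * ((1 - (p : ℂ)⁻¹) / Real.log p *
        ((2 * (2 * π * I * n / Real.log p) + 1) ^ ℓ / (2 * (2 * π * I * n / Real.log p) - 3) ^ (ℓ + 2)))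
    with hS2
  rw [show -(4 / π : ℂ) * (2 * π * (S1 + S2 + (A₀ + B₀ * ℓ) * (-1 / 3 : ℂ) ^ ℓ)) =
      -8 * S1 + -8 * S2 + (-8 * A₀ + -8 * B₀ * ℓ) * (-1 / 3 : ℂ) ^ ℓ by rw [← mul_assoc, hA]; ring,
    hS1, hS2, ← tsum_mul_left, ← tsum_mul_left, tsum_congr e1, tsum_congr e2]

end FourierCoefficients

end QuasiInner

end Literature.NumberTheory.ConnesConsani2021
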